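import Literature.MathematicalPhysics.QuantumFieldTheory.Balaban1983to89.B4Thm110RegionLp
import Literature.MathematicalPhysics.QuantumFieldTheory.Balaban1983to89.B4Thm110BoxDerivWalk

/-!
# `Balaban1983to89.B4Thm110RegionLpDeriv` — [Balaban1983RegularityDecay] THEOREM p. 573, INEQUALITY (1.10), DERIVATIVE
# MEMBER `|(D^η_{A,μ}G_k(Ω,A)f)(x)|` FOR A GENERAL REGION `Ω` UNDER THE PRINTED `R₀` RESTRICTION, END TO END, for a
# (1.7)-regular vector field — the probe `P = η^{-1}(E_{xy}[U(A_{xy})] − E_{xx}[1])` through r01 g6's mixed `L^p`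
# chain `B4Ineq110LpChain.probe_bound_lp`, first-letter input by the Leibniz rule (2.3) with `|∂^ηh_j| ≤ O(M^{-1})`
# (η-UNIFORM), the cube data of `B4Thm110RegionLp`

statement-level skeleton of published theorems with citation tags; proofs where landed; nothing here is a claim about the Yang–Mills mass gap

CITATION HEADER.  T. Bałaban, *Regularity and decay of lattice Green's functions*, Commun. Math. Phys. **89** (1983)
571–597, doi:10.1007/bf01214744 [Balaban1983RegularityDecay] (cell paper B4; held text
`paper:balaban1983-cmp89-regularity-decay`, journal page = PDF page + 570; pp. 572–573, 575–579).  Unit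
`lit-balaban-r01` gen 7 (B4 fold owner), HOME `run/shared/lean/pub/lit-balaban/`, SKELETON row **B4.Thm@573**.
Imports r01 g7 `B4Thm110RegionLp` (the print's `A_j`/`G_k(□_j,A_j)` on a general `Ω`: `atField`, `atGreen`, `boxFld`,
bridging identities, `good_of_R0`, the value member) and p17 g4 `B4Thm110BoxDerivWalk` (the derivative probe algebra:
`probe_mul_mulH` = Leibniz rule (2.3), `fld_probe_mulVec_self/ne`, `row_abs_sum_U_le`); through them r01 g6
`B4Ineq110LpChain.probe_bound_lp`, p35 g6 `B4Eq220CubeField` (Lemma 2.2 (2.17) value AND derivative sup members at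
`Ã_j`, (2.20), (2.21)), p35 g5 `B4Eq221HjRegion` (Lemma 2.1's `‖·‖_{2,2}`; the sizes `hsizeR_hZ` of `h_j` on a union of
`K`-blocks: `η^{-1}|h_j(y) − h_j(x)| ≤ s/K`).

WHAT IS PRINTED (verbatim, p. 573). «|(D^η_{A,μ}G_k(Ω, A)f)(x)| ≤ c₀ exp(−δ₀ dist(x, supp f)) ‖f‖_∞, (1.10) for x ∈ Ω,
dist(x, Ω^c) ≥ R₀», `(D^η_{A,μ}φ)(x) = η^{-1}(U(A_{⟨x,x+ηe_μ⟩})φ(x + ηe_μ) − φ(x))` ((1.3) p. 572); p. 575 (2.3)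
`D^η_{A,μ}(h_jφ)(x) = h_j(x)(D^η_{A,μ}φ)(x) + (∂^η_μh_j)(x)U(…)φ(x + ηe_μ)`; p. 577 «|∂^ηh_j| ≤ O(M^{-1})».

WHAT THIS MODULE PROVES (all in full).
* §1 `chainLetter` (the chain's letter `K_jG_jh_j` of (2.11) for the print's `A_j`) and **`chain_letter_inputs`**: the
  four per-cube inputs of r01 g6's chain (`γ ≥ ‖G_j‖`, the (2.20) sup letter, the graded (2.21) letters, the
  `‖·‖_{2,2}` letter at every cube) from the inputs in p35's vocabulary (box theorems at the interior cubes, Lemma 2.1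
  on `Ω ∩ □̂_j`) — the reusable half of `B4Thm110RegionLp.thm110_value_region_of_inputs`.
* §2 THE DERIVATIVE PROBE ON THE REGION: `cinv_mulVec_apply_of_mem`, `fld_pad_mulVec`, `supN_res_le`, and
  **`probe_atGreen_le`** — for an interior cube `□_j` whose `¾M`-core contains the bond `⟨x, x+e_μ⟩`:
  `‖η^{-1}(E_{xy}[U(A_{xy})] − E_{xx}[1])·G_j‖_{∞→∞} ≤ √N c_D` from the box's derivative sup member
  `‖D^η_{Ã,μ}G_k(□,Ã)Φ‖_∞ ≤ c_D‖Φ‖_∞` (Lemma 2.2 (2.17), `n = 1`).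
* §3 **`thm110_deriv_region_of_inputs`** — (1.10) derivative member on `fineDom n Ωc` from the per-cube inputs in
  p35's vocabulary (as in the value member, plus `c_D`), the first-letter input `α_P = √N c_D + (s/K)·N·max(√N c_G, 2)`
  by the Leibniz rule (2.3) with the η-uniform gradient size `η^{-1}|h_j(y) − h_j(x)| ≤ s/K`, `s = (d+1)(sup|h′| + sup|h″|)`
  (`B4Eq221HjRegion.hsizeR_hZ`), every structural hypothesis of `probe_bound_lp` discharged.
* §4 **`thm110_deriv_region`** — THE THEOREM (1.10), derivative member, GENERAL `Ω` under `R₀`, HYPOTHESIS-FREE but for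
  the print's own (same `∃K ∃c₀ ∀(c,β) ∃e₁ ∀…` shape as `B4Thm110RegionLp.thm110_value_region`; bond `⟨x, x + e_μ⟩ ⊂ Ω`;
  `R₀`: every unit label within `K(d+3) + 1` of the block of `x` in `Ω`):
  `|(D^η_{A,μ}G_k(Ω,A)f)(x)_i| ≤ c₀·V·e^{−D/(nK)}·‖f‖_∞`, `D^η_{A,μ} = B4Lemma21Region.regionDeriv` (the factor
  `η^{-1}` included — the constant is UNIFORM in `η`), and `thm110_deriv_region_unitBlock`.
HONEST SCOPE.  As `B4Thm110RegionLp` (abelian one-parameter flow, component field, staircase contours, `ℓ^∞` over sites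
and colours, the `L²`-comparison `V`; and (v1.1, referee note F3) the cube size `K` = the print's `M` is CHOSEN
existentially after `d`, `N`, the flow's Lipschitz constant, `L` and the windows, so `δ₀ = 1/K`, `R₀ = K(d+3)+1` inherit
that dependence — the print fixes `M` depending on `d` only); forward bond inside `Ω`.  One `abbrev` (`chainLetter`) and theorems; no `Prop`
fact, no `sorry`; axioms standard.  v1.1: docstring clause only, no declaration changed.
-/

namespace Literature.MathematicalPhysics.QuantumFieldTheory.Balaban1983to89.B4Thm110RegionLpDeriv

open Literature.MathematicalPhysics.QuantumFieldTheory.Balaban1983to89.B4Reflection242 (boxDom mem_boxDom nbrs mem_nbrs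
  blk blk_mem_boxDom)
open Literature.MathematicalPhysics.QuantumFieldTheory.Balaban1983to89.B4GaugeCovariance
open Literature.MathematicalPhysics.QuantumFieldTheory.Balaban1983to89.B4Commutators25to211 (mulH opK)
open Literature.MathematicalPhysics.QuantumFieldTheory.Balaban1983to89.B4Lower18 (fineDom mem_fineDom IsBlockUnion)
open Literature.MathematicalPhysics.QuantumFieldTheory.Balaban1983to89.B4Lower18Regular (e1 baseEmb stairContour
  base_le_of_blk)
open Literature.MathematicalPhysics.QuantumFieldTheory.Balaban1983to89.B4Lower18RegularRegion (regWt rBlkWt rbaseEmb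
  rstairContour regWt_nonneg rBlkWt_ne_zero compField)
open Literature.MathematicalPhysics.QuantumFieldTheory.Balaban1983to89.B4Lemma21Region (regionOp regionDeriv siteNorm
  covDeriv fld_covDeriv_mulVec_of_mem)
open Literature.MathematicalPhysics.QuantumFieldTheory.Balaban1983to89.B4Lemma22ReduceZero (Box opA greenA derivA)
open Literature.MathematicalPhysics.QuantumFieldTheory.Balaban1983to89.B4Lemma22Reduce231 (supN supN_nonneg le_supN
  supN_le siteNorm_nonneg siteNorm_zero fld_add)
open Literature.MathematicalPhysics.QuantumFieldTheory.Balaban1983to89.B4Lemma22EtaBox (vol vol_pos lpW lpW_nonneg)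
open Literature.MathematicalPhysics.QuantumFieldTheory.Balaban1983to89.B4Lemma22LpStair (lpM lpM_nonneg)
open Literature.MathematicalPhysics.QuantumFieldTheory.Balaban1983to89.B4PartitionUnity22 (hCube hCube_nonneg hCube_le_one
  hCube_ne_zero_imp mem_box_of_hCube_ne_zero hprof D1 D2 D1_nonneg D2_nonneg contDiff_hprof hasCompactSupport_hprof)
open Literature.MathematicalPhysics.QuantumFieldTheory.Balaban1983to89.B4Eq220PartitionSizes (hZ hBox)
open Literature.MathematicalPhysics.QuantumFieldTheory.Balaban1983to89.B4Eq220CommutatorField (kOp)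
open Literature.MathematicalPhysics.QuantumFieldTheory.Balaban1983to89.B4CubeFields22 (cubeField cubeField_eq_compField)
open Literature.MathematicalPhysics.QuantumFieldTheory.Balaban1983to89.B4CubeFieldHyps22 (aSeq_window cubeField_threshold)
open Literature.MathematicalPhysics.QuantumFieldTheory.Balaban1983to89.B4Eq220CubeField (lemma22_sup_cubeField
  eq220_cubeField_std eq221_cubeField)
open Literature.MathematicalPhysics.QuantumFieldTheory.Balaban1983to89.B4Eq221PsupCubeField (eq221_psup_cubeField_std)
open Literature.MathematicalPhysics.QuantumFieldTheory.Balaban1983to89.B4Eq221L2FactorRegion (acBond kOpR)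
open Literature.MathematicalPhysics.QuantumFieldTheory.Balaban1983to89.B4Eq221HjRegion (eq221_l2_region_hZ hsizeR_hZ)
open Literature.MathematicalPhysics.QuantumFieldTheory.Balaban1983to89.B4CubeOpReindex
open Literature.MathematicalPhysics.QuantumFieldTheory.Balaban1983to89.B4WalkRouteRegion (rpos labels labels_complete
  regWt_local rBlkWt_local green_mul_op)
open Literature.MathematicalPhysics.QuantumFieldTheory.Balaban1983to89.B4Ineq110WalkRoute (norm_mulH_le)
open Literature.MathematicalPhysics.QuantumFieldTheory.Balaban1983to89.B4Ineq110WalkRouteDeriv (unitOp_apply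
  unitOp_mul_mulH norm_unitOp_le fld_bondOp_mulVec)
open Literature.MathematicalPhysics.QuantumFieldTheory.Balaban1983to89.B4Thm110BoxDerivWalk (probe_mul_mulH
  fld_probe_mulVec_self fld_probe_mulVec_ne row_abs_sum_U_le)
open Literature.MathematicalPhysics.QuantumFieldTheory.Balaban1983to89.B4RegionCubeCarrier
open Literature.MathematicalPhysics.QuantumFieldTheory.Balaban1983to89.B4CubeGreenRegion
open Literature.MathematicalPhysics.QuantumFieldTheory.Balaban1983to89.B4LpNormTransfer
open Literature.MathematicalPhysics.QuantumFieldTheory.Balaban1983to89.B4Thm110RegionLp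
open Literature.MathematicalPhysics.QuantumFieldTheory.Balaban1983to89.B4Ineq110LpChain (lpv lpv_nonneg lvl lvl_zero
  lvl_succ lpv_two_le probe_bound_lp)
open scoped Matrix
open scoped Matrix.Norms.Operator

noncomputable section

variable {d : ℕ}

section Letters

variable {ι : Type} [Fintype ι] [DecidableEq ι]

/-- the mesh `n = L^k ≥ 1`. [folklore] -/
private theorem one_le_n (ℓ k : ℕ) : 1 ≤ (ℓ + 1) ^ k := Nat.one_le_pow _ _ (Nat.succ_pos ℓ)

/-! ## §1. The chain's letter for the print's `A_j` and its four inputs -/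

/-- **THE CHAIN's LETTER `K_jG_k(□_j,A_j)h_j` OF (2.11) FOR THE PRINT's `A_j` ON A GENERAL `Ω`** (cut cube operator of
`B4CubeGreenRegion`, `A_j`/`G_k(□_j,A_j)` of `B4Thm110RegionLp`, `h_j` at scale `M = nK`).
[cite: Balaban1983RegularityDecay, (2.11) p.576, (2.2) p.575] -/
abbrev chainLetter (F : OrthFlow ι) (κ : ℝ) (ℓ k : ℕ) (Ωc : Finset (Fin (d + 1) → ℤ)) (K : ℕ)
    (Ac : (Fin (d + 1) → ℤ) → Fin (d + 1) → ℝ) (a m2 : ℝ) (j : Fin (d + 1) → ℤ) :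
    Matrix (↥(fineDom ((ℓ + 1) ^ k) Ωc) × ι) (↥(fineDom ((ℓ + 1) ^ k) Ωc) × ι) ℝ :=
  opK (cutWt (cubeS ℓ k Ωc K j) (regWt ((ℓ + 1) ^ k) (fineDom ((ℓ + 1) ^ k) Ωc))) m2
      (B1.aSeq a ((ℓ : ℝ) + 1) k * (((((ℓ + 1) ^ k : ℕ)) : ℝ) ^ (d + 1))⁻¹)
      (rBlkWt ((ℓ + 1) ^ k) Ωc (fineDom ((ℓ + 1) ^ k) Ωc)) (cubeW F κ ℓ k Ωc K (atField ℓ k Ωc K Ac j) j)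
      (cubeT F κ ℓ k Ωc K (atField ℓ k Ωc K Ac j) j)
      (fun z => hCube ((((ℓ + 1) ^ k : ℕ) : ℝ) * K) j (rpos ((ℓ + 1) ^ k) Ωc z))
    * atGreen F κ ℓ k Ωc K Ac a m2 j
    * mulH (ι := ι) (fun z => hCube ((((ℓ + 1) ^ k : ℕ) : ℝ) * K) j (rpos ((ℓ + 1) ^ k) Ωc z))

/-- **THE FOUR PER-CUBE INPUTS OF THE MIXED CHAIN FOR THE PRINT's `A_j`, `G_k(□_j,A_j)` ON A GENERAL `Ω`, FROM THE
INPUTS IN THE LEMMA-2.2 / LEMMA-2.1 LINEAGES' VOCABULARY** (the reusable half of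
`B4Thm110RegionLp.thm110_value_region_of_inputs`): `‖G_j‖ ≤ max(√N c_G, 2)` and `‖K_jG_jh_j‖_{∞→∞} ≤ √N c_K` at the
interior cubes, the graded letters `‖K_jG_jh_j g‖_{lvl(t−1)} ≤ √N c_K‖g‖_{lvl t}` at the interior cubes, and
`‖K_jG_jh_j g‖_{2,η} ≤ √N c_K‖g‖_{2,η}` at every cube. [cite: Balaban1983RegularityDecay, (2.17)–(2.21) p.578, Lemma 2.1 (2.15) p.577] -/
theorem chain_letter_inputs (F : OrthFlow ι) (κ : ℝ) {ℓ k : ℕ} (hℓ : 1 ≤ ℓ) (hk : 1 ≤ k)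
    (hn : 1 ≤ (ℓ + 1) ^ k) (Ωc : Finset (Fin (d + 1) → ℤ)) {K : ℕ} (hK8 : 8 ≤ K) {a m2 : ℝ}
    (ha : 0 < a) (hm : 0 ≤ m2) (Ac : (Fin (d + 1) → ℤ) → Fin (d + 1) → ℝ) {cG cK : ℝ} (hcG : 0 ≤ cG) (hcK : 0 ≤ cK)
    {n₀ : ℕ} (hn₀ : 0 < n₀)
    (hG : ∀ j, cubeLabels K j ⊆ Ωc → ∀ Φ : ↥(Box d ℓ k fun _ : Fin (d + 1) => 2 * K) × ι → ℝ,
      supN (greenA d F κ ℓ k a m2 (fun _ => 2 * K) (baseEmb hn _) (stairContour hn _) (boxFld ℓ k K Ac j) *ᵥ Φ)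
        ≤ cG * supN Φ)
    (h0 : ∀ j, cubeLabels K j ⊆ Ωc → ∀ Φ : ↥(Box d ℓ k fun _ : Fin (d + 1) => 2 * K) × ι → ℝ,
      supN (kOp F κ ((ℓ + 1) ^ k) (B1.aSeq a ((ℓ : ℝ) + 1) k) m2 (fun _ => 2 * K) (baseEmb hn _) (stairContour hn _)
            (boxFld ℓ k K Ac j) (hBox ((ℓ + 1) ^ k) K (fun _ => 2 * K) (fun _ => 1))
          *ᵥ (greenA d F κ ℓ k a m2 (fun _ => 2 * K) (baseEmb hn _) (stairContour hn _) (boxFld ℓ k K Ac j)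
            *ᵥ (mulH (ι := ι) (hBox ((ℓ + 1) ^ k) K (fun _ => 2 * K) (fun _ => 1)) *ᵥ Φ))) ≤ cK * supN Φ)
    (h1 : ∀ j, cubeLabels K j ⊆ Ωc → ∀ p : ℝ, 2 * (n₀ : ℝ) ≤ p →
      ∀ Φ : ↥(Box d ℓ k fun _ : Fin (d + 1) => 2 * K) × ι → ℝ,
      supN (kOp F κ ((ℓ + 1) ^ k) (B1.aSeq a ((ℓ : ℝ) + 1) k) m2 (fun _ => 2 * K) (baseEmb hn _) (stairContour hn _)
            (boxFld ℓ k K Ac j) (hBox ((ℓ + 1) ^ k) K (fun _ => 2 * K) (fun _ => 1))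
          *ᵥ (greenA d F κ ℓ k a m2 (fun _ => 2 * K) (baseEmb hn _) (stairContour hn _) (boxFld ℓ k K Ac j)
            *ᵥ (mulH (ι := ι) (hBox ((ℓ + 1) ^ k) K (fun _ => 2 * K) (fun _ => 1)) *ᵥ Φ))) ≤ cK * lpW d ℓ k p Φ)
    (hg : ∀ j, cubeLabels K j ⊆ Ωc → ∀ p q : ℝ, 1 ≤ p → p ≤ q → p⁻¹ - q⁻¹ ≤ (2 * (n₀ : ℝ))⁻¹ →
      ∀ Φ : ↥(Box d ℓ k fun _ : Fin (d + 1) => 2 * K) × ι → ℝ,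
      lpW d ℓ k q (kOp F κ ((ℓ + 1) ^ k) (B1.aSeq a ((ℓ : ℝ) + 1) k) m2 (fun _ => 2 * K) (baseEmb hn _)
            (stairContour hn _) (boxFld ℓ k K Ac j) (hBox ((ℓ + 1) ^ k) K (fun _ => 2 * K) (fun _ => 1))
          *ᵥ (greenA d F κ ℓ k a m2 (fun _ => 2 * K) (baseEmb hn _) (stairContour hn _) (boxFld ℓ k K Ac j)
            *ᵥ (mulH (ι := ι) (hBox ((ℓ + 1) ^ k) K (fun _ => 2 * K) (fun _ => 1)) *ᵥ Φ))) ≤ cK * lpW d ℓ k p Φ)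
    (hb : ∀ (j : Fin (d + 1) → ℤ) (Φ : ↥(fineDom ((ℓ + 1) ^ k) (subLabels Ωc K j)) × ι → ℝ),
      lpW d ℓ k 2 (opK (regWt ((ℓ + 1) ^ k) (fineDom ((ℓ + 1) ^ k) (subLabels Ωc K j))) m2
            (B1.aSeq a ((ℓ : ℝ) + 1) k * (((((ℓ + 1) ^ k : ℕ)) : ℝ) ^ (d + 1))⁻¹)
            (rBlkWt ((ℓ + 1) ^ k) (subLabels Ωc K j) (fineDom ((ℓ + 1) ^ k) (subLabels Ωc K j)))
            (fieldLink F κ (acBond (subLabels Ωc K j) Ac))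
            (contourTrans (fieldLink F κ (acBond (subLabels Ωc K j) Ac)) (rbaseEmb hn (subLabels Ωc K j))
              (rstairContour hn (subLabels Ωc K j)))
            (fun a : ↥(fineDom ((ℓ + 1) ^ k) (subLabels Ωc K j)) => hZ ((ℓ + 1) ^ k) K j a.1)
          *ᵥ ((covOp (regWt ((ℓ + 1) ^ k) (fineDom ((ℓ + 1) ^ k) (subLabels Ωc K j))) m2
                (B1.aSeq a ((ℓ : ℝ) + 1) k * (((((ℓ + 1) ^ k : ℕ)) : ℝ) ^ (d + 1))⁻¹)
                (rBlkWt ((ℓ + 1) ^ k) (subLabels Ωc K j) (fineDom ((ℓ + 1) ^ k) (subLabels Ωc K j)))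
                (fieldLink F κ (acBond (subLabels Ωc K j) Ac))
                (contourTrans (fieldLink F κ (acBond (subLabels Ωc K j) Ac)) (rbaseEmb hn (subLabels Ωc K j))
                  (rstairContour hn (subLabels Ωc K j))))⁻¹
            *ᵥ (mulH (ι := ι) (fun a : ↥(fineDom ((ℓ + 1) ^ k) (subLabels Ωc K j)) => hZ ((ℓ + 1) ^ k) K j a.1)
              *ᵥ Φ))) ≤ cK * lpW d ℓ k 2 Φ)
    :
    (∀ j, cubeLabels K j ⊆ Ωc → ‖atGreen F κ ℓ k Ωc K Ac a m2 j‖ ≤ max (Real.sqrt (Fintype.card ι) * cG) 2) ∧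
    (∀ j, cubeLabels K j ⊆ Ωc → ‖chainLetter F κ ℓ k Ωc K Ac a m2 j‖ ≤ Real.sqrt (Fintype.card ι) * cK) ∧
    (∀ j, cubeLabels K j ⊆ Ωc → ∀ t : ℕ, 1 ≤ t → t ≤ n₀ → ∀ g : ↥(fineDom ((ℓ + 1) ^ k) Ωc) × ι → ℝ,
      lvl (vol d ℓ k)⁻¹ n₀ (t - 1) (chainLetter F κ ℓ k Ωc K Ac a m2 j *ᵥ g)
        ≤ Real.sqrt (Fintype.card ι) * cK * lvl (vol d ℓ k)⁻¹ n₀ t g) ∧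
    (∀ (j : Fin (d + 1) → ℤ) (g : ↥(fineDom ((ℓ + 1) ^ k) Ωc) × ι → ℝ),
      lpv (vol d ℓ k)⁻¹ 2 (chainLetter F κ ℓ k Ωc K Ac a m2 j *ᵥ g) ≤ Real.sqrt (Fintype.card ι) * cK * lpv (vol d ℓ k)⁻¹ 2 g) := by
  -- abbreviations
  have hK1 : 1 ≤ K := le_trans (by norm_num) hK8
  have hn2 : 2 ≤ (ℓ + 1) ^ k := by
    calc 2 ≤ ℓ + 1 := by omega
      _ = (ℓ + 1) ^ 1 := (pow_one _).symm
      _ ≤ (ℓ + 1) ^ k := Nat.pow_le_pow_right (Nat.succ_pos ℓ) hk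
  have hnr : (1 : ℝ) ≤ ((((ℓ + 1) ^ k : ℕ)) : ℝ) := by exact_mod_cast hn
  have hn0 : (0 : ℝ) < ((((ℓ + 1) ^ k : ℕ)) : ℝ) := by positivity
  have hKr : (1 : ℝ) ≤ K := by exact_mod_cast hK1
  have hM : (0 : ℝ) < ((((ℓ + 1) ^ k : ℕ)) : ℝ) * K := by positivity
  have hL : (1 : ℝ) < (ℓ : ℝ) + 1 := by
    have : (1 : ℝ) ≤ ℓ := by exact_mod_cast hℓ
    linarith
  have hak : 0 < B1.aSeq a ((ℓ : ℝ) + 1) k := B1.aSeq_pos ha hL hk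
  have hak' : 0 < B1.aSeq a ((ℓ : ℝ) + 1) k * (((((ℓ + 1) ^ k : ℕ)) : ℝ) ^ (d + 1))⁻¹ := by positivity
  have hw : (0 : ℝ) < (vol d ℓ k)⁻¹ := inv_pos.2 (vol_pos d ℓ k)
  have hN : (0 : ℝ) ≤ Real.sqrt (Fintype.card ι) := Real.sqrt_nonneg _
  -- the injections of the cubes
  have heB : ∀ {j : Fin (d + 1) → ℤ} (hj : cubeLabels K j ⊆ Ωc),
      Function.Injective (boxEmb ℓ k (fun _ => 2 * K) (cshift K j) (shift_mem_of_cube_subset hj)) :=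
    fun hj => boxEmb_injective ℓ k _ _ _
  have heI : ∀ j : Fin (d + 1) → ℤ, Function.Injective (incl hn (subLabels_subset Ωc K j)) :=
    fun j => incl_injective hn _
  -- the support of `h_j` lies in the cube
  have hsupp : ∀ (j : Fin (d + 1) → ℤ) (z : ↥(fineDom ((ℓ + 1) ^ k) Ωc)),
      hCube (((((ℓ + 1) ^ k : ℕ)) : ℝ) * K) j (rpos ((ℓ + 1) ^ k) Ωc z) ≠ 0 → cubeS ℓ k Ωc K j z :=
    fun j z hz => cubeS_of_hCube_ne_zero ℓ k Ωc hK1 j z hz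
  -- THE INTERIOR-CUBE LETTER IS THE PADDED BOX LETTER OF P35
  have hLB : ∀ {j : Fin (d + 1) → ℤ} (hj : cubeLabels K j ⊆ Ωc),
      opK (cutWt (cubeS ℓ k Ωc K j) (regWt ((ℓ + 1) ^ k) (fineDom ((ℓ + 1) ^ k) Ωc))) m2
          (B1.aSeq a ((ℓ : ℝ) + 1) k * ((((((ℓ + 1) ^ k : ℕ)) : ℝ)) ^ (d + 1))⁻¹) (rBlkWt ((ℓ + 1) ^ k) Ωc (fineDom ((ℓ + 1) ^ k) Ωc))
          (cubeW F κ ℓ k Ωc K (atField ℓ k Ωc K Ac j) j) (cubeT F κ ℓ k Ωc K (atField ℓ k Ωc K Ac j) j)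
          (fun z => hCube (((((ℓ + 1) ^ k : ℕ)) : ℝ) * K) j (rpos ((ℓ + 1) ^ k) Ωc z))
        * atGreen F κ ℓ k Ωc K Ac a m2 j * mulH (ι := ι) (fun z => hCube (((((ℓ + 1) ^ k : ℕ)) : ℝ) * K) j (rpos ((ℓ + 1) ^ k) Ωc z))
      = pad (boxEmb ℓ k (fun _ => 2 * K) (cshift K j) (shift_mem_of_cube_subset hj))
          (kOp F κ ((ℓ + 1) ^ k) (B1.aSeq a ((ℓ : ℝ) + 1) k) m2 (fun _ => 2 * K) (baseEmb hn _) (stairContour hn _)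
              (boxFld ℓ k K Ac j) (hBox ((ℓ + 1) ^ k) K (fun _ => 2 * K) (fun _ => 1))
            * greenA d F κ ℓ k a m2 (fun _ => 2 * K) (baseEmb hn _) (stairContour hn _) (boxFld ℓ k K Ac j)
            * mulH (ι := ι) (hBox ((ℓ + 1) ^ k) K (fun _ => 2 * K) (fun _ => 1))) := by
    intro j hj
    rw [atGreen_good F κ ℓ k Ωc K Ac a m2 hj, cube_letter_b_B F κ ℓ k Ωc K a m2 _ hj _ (hsupp j),
      boxLetter_eq F κ ℓ k Ωc Ac hn hK1 a m2 hj]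
  -- THE BOUNDARY-CUBE LETTER IS THE PADDED SUB-REGION LETTER OF P35
  have hLI : ∀ {j : Fin (d + 1) → ℤ} (hj : ¬ cubeLabels K j ⊆ Ωc),
      opK (cutWt (cubeS ℓ k Ωc K j) (regWt ((ℓ + 1) ^ k) (fineDom ((ℓ + 1) ^ k) Ωc))) m2
          (B1.aSeq a ((ℓ : ℝ) + 1) k * ((((((ℓ + 1) ^ k : ℕ)) : ℝ)) ^ (d + 1))⁻¹) (rBlkWt ((ℓ + 1) ^ k) Ωc (fineDom ((ℓ + 1) ^ k) Ωc))
          (cubeW F κ ℓ k Ωc K (atField ℓ k Ωc K Ac j) j) (cubeT F κ ℓ k Ωc K (atField ℓ k Ωc K Ac j) j)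
          (fun z => hCube (((((ℓ + 1) ^ k : ℕ)) : ℝ) * K) j (rpos ((ℓ + 1) ^ k) Ωc z))
        * atGreen F κ ℓ k Ωc K Ac a m2 j * mulH (ι := ι) (fun z => hCube (((((ℓ + 1) ^ k : ℕ)) : ℝ) * K) j (rpos ((ℓ + 1) ^ k) Ωc z))
      = pad (incl hn (subLabels_subset Ωc K j))
          (opK (regWt ((ℓ + 1) ^ k) (fineDom ((ℓ + 1) ^ k) (subLabels Ωc K j))) m2 (B1.aSeq a ((ℓ : ℝ) + 1) k * ((((((ℓ + 1) ^ k : ℕ)) : ℝ)) ^ (d + 1))⁻¹)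
              (rBlkWt ((ℓ + 1) ^ k) (subLabels Ωc K j) (fineDom ((ℓ + 1) ^ k) (subLabels Ωc K j)))
              (fieldLink F κ (acBond (subLabels Ωc K j) Ac))
              (contourTrans (fieldLink F κ (acBond (subLabels Ωc K j) Ac)) (rbaseEmb hn (subLabels Ωc K j))
                (rstairContour hn (subLabels Ωc K j)))
              (fun a : ↥(fineDom ((ℓ + 1) ^ k) (subLabels Ωc K j)) => hZ ((ℓ + 1) ^ k) K j a.1)
            * (covOp (regWt ((ℓ + 1) ^ k) (fineDom ((ℓ + 1) ^ k) (subLabels Ωc K j))) m2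
                (B1.aSeq a ((ℓ : ℝ) + 1) k * ((((((ℓ + 1) ^ k : ℕ)) : ℝ)) ^ (d + 1))⁻¹)
                (rBlkWt ((ℓ + 1) ^ k) (subLabels Ωc K j) (fineDom ((ℓ + 1) ^ k) (subLabels Ωc K j)))
                (fieldLink F κ (acBond (subLabels Ωc K j) Ac))
                (contourTrans (fieldLink F κ (acBond (subLabels Ωc K j) Ac)) (rbaseEmb hn (subLabels Ωc K j))
                  (rstairContour hn (subLabels Ωc K j))))⁻¹
            * mulH (ι := ι) (fun a : ↥(fineDom ((ℓ + 1) ^ k) (subLabels Ωc K j)) => hZ ((ℓ + 1) ^ k) K j a.1)) := by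
    intro j hj
    rw [atGreen_bad F κ ℓ k Ωc K Ac a m2 hj, cube_letter_b_I F κ ℓ k Ωc K m2 _ _ j _ (hsupp j),
      subLetter_eq F κ ℓ k Ωc K Ac hn m2 _ hj]
  refine ⟨?_, ?_, ?_, ?_⟩
  · intro j hj
    rw [atGreen_good F κ ℓ k Ωc K Ac a m2 hj]
    refine (norm_cubeGreenB_le F κ ℓ k Ωc K hn2 a hm _ hj).trans (max_le_max ?_ ?_)
    · rw [subFieldB_atField ℓ k Ωc Ac hK1 hj]
      exact linfty_opNorm_le_of_supN _ hcG (hG j hj)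
    · rw [div_le_iff₀ (by positivity)]
      nlinarith
  · intro j hj
    dsimp only [chainLetter]
    rw [hLB hj, norm_pad (heB hj)]
    refine linfty_opNorm_le_of_supN _ hcK fun Φ => ?_
    rw [← Matrix.mulVec_mulVec, ← Matrix.mulVec_mulVec]
    exact h0 j hj Φ
  · intro j hj t ht1 ht2 g
    dsimp only [chainLetter]
    obtain ⟨t', rfl⟩ : ∃ t', t = t' + 1 := ⟨t - 1, by omega⟩
    simp only [Nat.add_sub_cancel]
    rw [hLB hj]
    rcases Nat.eq_zero_or_pos t' with ht0 | htpos
    · -- `‖·‖_{∞, p₁}`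
      subst ht0
      rw [lvl_zero, lvl_succ, norm_pad_mulVec (heB hj)]
      have hp0 : (0 : ℝ) < 2 * (n₀ : ℝ) / ((0 + 1 : ℕ) : ℝ) := by positivity
      have hp : 2 * (n₀ : ℝ) ≤ 2 * (n₀ : ℝ) / ((0 + 1 : ℕ) : ℝ) := by norm_num
      have hin := h1 j hj _ hp (fun q : ↥(Box d ℓ k fun _ : Fin (d + 1) => 2 * K) × ι =>
        g (boxEmb ℓ k (fun _ => 2 * K) (cshift K j) (shift_mem_of_cube_subset hj) q.1, q.2))
      rw [Matrix.mulVec_mulVec, Matrix.mulVec_mulVec] at hin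
      refine (norm_bound_of_supN_lpW_bound d ℓ k hp0 hcK hin).trans ?_
      exact mul_le_mul_of_nonneg_left (lpv_res_le (heB hj) hw.le hp0 g) (by positivity)
    · -- `‖·‖_{p₁/t′, p₁/(t′+1)}`
      rw [lvl, if_neg htpos.ne', lvl, if_neg (Nat.succ_ne_zero _), lpv_pad_mulVec (heB hj) (by positivity)]
      have ht'r : (1 : ℝ) ≤ t' := by exact_mod_cast htpos
      have ht2r : (t' : ℝ) + 1 ≤ n₀ := by exact_mod_cast ht2
      have hp0 : (0 : ℝ) < 2 * (n₀ : ℝ) / ((t' + 1 : ℕ) : ℝ) := by positivity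
      have hp1 : (1 : ℝ) ≤ 2 * (n₀ : ℝ) / ((t' + 1 : ℕ) : ℝ) := by
        rw [le_div_iff₀ (by positivity)]; push_cast; linarith
      have hpq : 2 * (n₀ : ℝ) / ((t' + 1 : ℕ) : ℝ) ≤ 2 * (n₀ : ℝ) / (t' : ℝ) := by
        apply div_le_div_of_nonneg_left (by positivity) (by positivity); push_cast; linarith
      have hq2 : (2 : ℝ) ≤ 2 * (n₀ : ℝ) / (t' : ℝ) := by
        rw [le_div_iff₀ (by positivity)]; linarith
      have hdiff : (2 * (n₀ : ℝ) / ((t' + 1 : ℕ) : ℝ))⁻¹ - (2 * (n₀ : ℝ) / (t' : ℝ))⁻¹ ≤ (2 * (n₀ : ℝ))⁻¹ := by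
        have hn₀r : (0 : ℝ) < n₀ := by exact_mod_cast hn₀
        rw [inv_div, inv_div]
        push_cast
        have : ((t' : ℝ) + 1) / (2 * n₀) - t' / (2 * n₀) = (2 * (n₀ : ℝ))⁻¹ := by
          field_simp; ring
        rw [this]
      have hin := hg j hj _ _ hp1 hpq hdiff (fun q : ↥(Box d ℓ k fun _ : Fin (d + 1) => 2 * K) × ι =>
        g (boxEmb ℓ k (fun _ => 2 * K) (cshift K j) (shift_mem_of_cube_subset hj) q.1, q.2))
      rw [Matrix.mulVec_mulVec, Matrix.mulVec_mulVec] at hin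
      refine (lpv_bound_of_lpW_bound d ℓ k hp0 hq2 hcK hin).trans ?_
      exact mul_le_mul_of_nonneg_left (lpv_res_le (heB hj) hw.le hp0 g) (by positivity)
  · intro j g
    dsimp only [chainLetter]
    by_cases hj : cubeLabels K j ⊆ Ωc
    · rw [hLB hj, lpv_pad_mulVec (heB hj) two_pos]
      have hdiff : (2 : ℝ)⁻¹ - (2 : ℝ)⁻¹ ≤ (2 * (n₀ : ℝ))⁻¹ := by
        rw [sub_self]; positivity
      have hin := hg j hj 2 2 (by norm_num) le_rfl hdiff
        (fun q : ↥(Box d ℓ k fun _ : Fin (d + 1) => 2 * K) × ι =>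
          g (boxEmb ℓ k (fun _ => 2 * K) (cshift K j) (shift_mem_of_cube_subset hj) q.1, q.2))
      rw [Matrix.mulVec_mulVec, Matrix.mulVec_mulVec] at hin
      refine (lpv_bound_of_lpW_bound d ℓ k two_pos le_rfl hcK hin).trans ?_
      exact mul_le_mul_of_nonneg_left (lpv_res_le (heB hj) hw.le two_pos g) (by positivity)
    · rw [hLI hj, lpv_pad_mulVec (heI j) two_pos]
      have hin := hb j (fun q : ↥(fineDom ((ℓ + 1) ^ k) (subLabels Ωc K j)) × ι =>
        g (incl hn (subLabels_subset Ωc K j) q.1, q.2))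
      rw [Matrix.mulVec_mulVec, Matrix.mulVec_mulVec] at hin
      refine (lpv_bound_of_lpW_bound d ℓ k two_pos le_rfl hcK hin).trans ?_
      exact mul_le_mul_of_nonneg_left (lpv_res_le (heI j) hw.le two_pos g) (by positivity)

end Letters

/-! ## §2. The derivative probe `η^{-1}(E_{xy}[U(A_{xy})] − E_{xx}[1])` against the cube propagators of a general `Ω` -/

section Probe

variable {ι : Type} [Fintype ι] [DecidableEq ι]

/-- the rows of the harmless diagonal `cinv` vanish ON the cube. [cite: Balaban1983RegularityDecay, (2.2) p.575, dictionary] -/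
theorem cinv_mulVec_apply_of_mem {X : Type} [Fintype X] [DecidableEq X] (S : X → Prop) [DecidablePred S]
    (c : X → X → ℝ) (m2 : ℝ) (Φ : X × ι → ℝ) {z : X} (hz : S z) (k : ι) : (cinv S c m2 *ᵥ Φ) (z, k) = 0 := by
  simp only [Matrix.mulVec, dotProduct, cinv, Matrix.of_apply]
  refine Finset.sum_eq_zero fun p _ => ?_
  rw [if_neg, zero_mul]
  rintro ⟨-, h⟩
  exact h hz

omit [DecidableEq ι] in
/-- the padded operator read at an image site is the operator on the sub-carrier. [cite: Balaban1983RegularityDecay, (2.2) p.575, dictionary] -/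
theorem fld_pad_mulVec {X X' : Type} [Fintype X] [Fintype X'] [DecidableEq X] {e : X' → X}
    (he : Function.Injective e) (B : Matrix (X' × ι) (X' × ι) ℝ) (g : X × ι → ℝ) (a : X') :
    fld (pad e B *ᵥ g) (e a) = fld (B *ᵥ fun q : X' × ι => g (e q.1, q.2)) a :=
  funext fun i => pad_mulVec_apply_img he B g a i

omit [DecidableEq ι] in
/-- restriction along a map does not increase the sup norm. [folklore] -/
private theorem supN_res_le {X X' : Type*} [Fintype X] [Fintype X'] (e : X' → X) (Φ : X × ι → ℝ) :
    supN (fun q : X' × ι => Φ (e q.1, q.2)) ≤ supN Φ :=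
  supN_le (supN_nonneg Φ) fun a => le_supN Φ (e a)

/-- **THE DERIVATIVE PROBE AGAINST THE CUBE PROPAGATOR OF AN INTERIOR CUBE SEEING THE BOND**: for an interior cube
`□_j` (`□̂_j ⊆ Ω`) whose `¾M`-core contains `x` and `y = x + e_μ`,
`‖η^{-1}(E_{xy}[U(A_{xy})] − E_{xx}[1])·G_k(□_j,Ã_j)‖_{ℓ∞→ℓ∞} ≤ √N·c_D`, where `c_D` bounds the box's derivative sup
member `‖D^η_{Ã,μ}G_k(□,Ã)Φ‖_∞ ≤ c_D‖Φ‖_∞` (Lemma 2.2 (2.17), `n = 1`): the probe reads the padded box Green's function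
through the bond `⟨a, a + e_μ⟩` of the box (`Ã_j = A` on the core), and does not see the harmless diagonal off the cube.
[cite: Balaban1983RegularityDecay, (1.3) p.572, Lemma 2.2 (2.17) p.578, §2 p.575 «Ã_j … equal to A on … |x − Mj| ≤ ¾M»] -/
theorem probe_atGreen_le (F : OrthFlow ι) (κ : ℝ) {ℓ k : ℕ} (hn : 1 ≤ (ℓ + 1) ^ k) (Ωc : Finset (Fin (d + 1) → ℤ))
    {K : ℕ} (hK : 1 ≤ K) (Ac : (Fin (d + 1) → ℤ) → Fin (d + 1) → ℝ) (a m2 : ℝ) {j : Fin (d + 1) → ℤ}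
    (hgood : cubeLabels K j ⊆ Ωc) (μ : Fin (d + 1)) (x : ↥(fineDom ((ℓ + 1) ^ k) Ωc))
    (hxμ : x.1 + e1 μ ∈ fineDom ((ℓ + 1) ^ k) Ωc)
    (hx : ∀ ν, |rpos ((ℓ + 1) ^ k) Ωc x ν - ((((ℓ + 1) ^ k : ℕ) : ℝ) * K) * j ν|
      ≤ 3 / 4 * ((((ℓ + 1) ^ k : ℕ) : ℝ) * K))
    (hy : ∀ ν, |rpos ((ℓ + 1) ^ k) Ωc ⟨x.1 + e1 μ, hxμ⟩ ν - ((((ℓ + 1) ^ k : ℕ) : ℝ) * K) * j ν|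
      ≤ 3 / 4 * ((((ℓ + 1) ^ k : ℕ) : ℝ) * K))
    {cD : ℝ} (hcD : 0 ≤ cD)
    (hDG : ∀ Φ : ↥(Box d ℓ k fun _ : Fin (d + 1) => 2 * K) × ι → ℝ,
      supN (derivA d F κ ℓ k (fun _ => 2 * K) (boxFld ℓ k K Ac j) μ
        *ᵥ (greenA d F κ ℓ k a m2 (fun _ => 2 * K) (baseEmb hn _) (stairContour hn _) (boxFld ℓ k K Ac j) *ᵥ Φ))
        ≤ cD * supN Φ) :
    ‖(((((ℓ + 1) ^ k : ℕ) : ℝ)) • (unitOp x ⟨x.1 + e1 μ, hxμ⟩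
          (fieldLink F κ (acBond Ωc Ac) x ⟨x.1 + e1 μ, hxμ⟩) - unitOp x x (1 : Matrix ι ι ℝ)))
        * atGreen F κ ℓ k Ωc K Ac a m2 j‖ ≤ Real.sqrt (Fintype.card ι) * cD := by
  set y : ↥(fineDom ((ℓ + 1) ^ k) Ωc) := ⟨x.1 + e1 μ, hxμ⟩ with hy_def
  have he := boxEmb_injective ℓ k (fun _ => 2 * K) (cshift K j) (shift_mem_of_cube_subset hgood)
  -- the bond read on the box
  obtain ⟨a0, ha0⟩ := (cubeS_iff_boxEmb ℓ k Ωc K hgood x).1 (cubeS_of_core ℓ k Ωc hK j x hx)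
  obtain ⟨b0, hb0⟩ := (cubeS_iff_boxEmb ℓ k Ωc K hgood y).1 (cubeS_of_core ℓ k Ωc hK j y hy)
  have hba : b0.1 = a0.1 + e1 μ := by
    have h1 : b0.1 + (fun i => (((ℓ + 1) ^ k : ℕ) : ℤ) * cshift K j i) = x.1 + e1 μ := congrArg Subtype.val hb0
    have h2 : a0.1 + (fun i => (((ℓ + 1) ^ k : ℕ) : ℤ) * cshift K j i) = x.1 := congrArg Subtype.val ha0
    have h3 : b0.1 + (fun i => (((ℓ + 1) ^ k : ℕ) : ℤ) * cshift K j i)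
        = (a0.1 + e1 μ) + (fun i => (((ℓ + 1) ^ k : ℕ) : ℤ) * cshift K j i) := by
      rw [h1, ← h2]; abel
    exact add_right_cancel h3
  have hab : a0.1 + e1 μ ∈ Box d ℓ k (fun _ : Fin (d + 1) => 2 * K) := hba ▸ b0.2
  have hb : boxEmb ℓ k (fun _ => 2 * K) (cshift K j) (shift_mem_of_cube_subset hgood) ⟨a0.1 + e1 μ, hab⟩ = y := by
    rw [← hb0]; congr 1; exact Subtype.ext hba.symm
  -- the link variable of the bond is that of `Ã_j` on the box (core: `Ã_j = A`)
  have hW : fieldLink F κ (boxFld ℓ k K Ac j) a0 ⟨a0.1 + e1 μ, hab⟩ = fieldLink F κ (acBond Ωc Ac) x y := by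
    unfold fieldLink
    rw [← subFieldB_atField ℓ k Ωc Ac hK hgood]
    show F.U (κ * atField ℓ k Ωc K Ac j (boxEmb ℓ k (fun _ => 2 * K) (cshift K j) (shift_mem_of_cube_subset hgood) a0)
      (boxEmb ℓ k (fun _ => 2 * K) (cshift K j) (shift_mem_of_cube_subset hgood) ⟨a0.1 + e1 μ, hab⟩)) = _
    rw [ha0, hb, atField_core ℓ k Ωc Ac hK j x y hx hy]
  rw [atGreen_good F κ ℓ k Ωc K Ac a m2 hgood, cubeGreenB]
  refine linfty_opNorm_le_of_supN _ hcD fun Φ => ?_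
  rw [← Matrix.mulVec_mulVec]
  set Gb := greenA d F κ ℓ k a m2 (fun _ => 2 * K) (baseEmb (Nat.one_le_pow k (ℓ + 1) (Nat.succ_pos ℓ)) _)
    (stairContour (Nat.one_le_pow k (ℓ + 1) (Nat.succ_pos ℓ)) _) (subFieldB ℓ k Ωc K hgood (atField ℓ k Ωc K Ac j))
    with hGb
  set Ψ := (pad (boxEmb ℓ k (fun _ => 2 * K) (cshift K j) (shift_mem_of_cube_subset hgood)) Gb
    + cinv (cubeS ℓ k Ωc K j) (regWt ((ℓ + 1) ^ k) (fineDom ((ℓ + 1) ^ k) Ωc)) m2) *ᵥ Φ with hΨ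
  set Φ' : ↥(Box d ℓ k fun _ : Fin (d + 1) => 2 * K) × ι → ℝ := fun q =>
    Φ (boxEmb ℓ k (fun _ => 2 * K) (cshift K j) (shift_mem_of_cube_subset hgood) q.1, q.2) with hΦ'
  -- `Ψ` read at `x` and `y` is `G_k(□,Ã)Φ′` read at `a₀` and `a₀ + e_μ`
  have hread : ∀ (z : ↥(fineDom ((ℓ + 1) ^ k) Ωc)) (c : ↥(Box d ℓ k fun _ : Fin (d + 1) => 2 * K)),
      boxEmb ℓ k (fun _ => 2 * K) (cshift K j) (shift_mem_of_cube_subset hgood) c = z →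
      fld Ψ z = fld (Gb *ᵥ Φ') c := by
    intro z c hc
    have hS : cubeS ℓ k Ωc K j z := (cubeS_iff_boxEmb ℓ k Ωc K hgood z).2 ⟨c, hc⟩
    rw [hΨ, Matrix.add_mulVec, fld_add]
    have h0 : fld (cinv (cubeS ℓ k Ωc K j) (regWt ((ℓ + 1) ^ k) (fineDom ((ℓ + 1) ^ k) Ωc)) m2 *ᵥ Φ) z = 0 :=
      funext fun i => cinv_mulVec_apply_of_mem _ _ m2 Φ hS i
    rw [h0, add_zero, ← hc, fld_pad_mulVec he]
  refine supN_le (mul_nonneg hcD (supN_nonneg Φ)) fun z => ?_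
  by_cases hz : z = x
  · subst hz
    rw [fld_probe_mulVec_self, hread z a0 ha0, hread y ⟨a0.1 + e1 μ, hab⟩ hb, ← hW,
      ← fld_covDeriv_mulVec_of_mem ((ℓ + 1) ^ k) (fieldLink F κ (boxFld ℓ k K Ac j)) (Gb *ᵥ Φ') hab]
    have hG' : Gb = greenA d F κ ℓ k a m2 (fun _ => 2 * K) (baseEmb hn _) (stairContour hn _) (boxFld ℓ k K Ac j) := by
      rw [hGb, subFieldB_atField ℓ k Ωc Ac hK hgood]
    rw [hG']
    exact (le_supN _ _).trans ((hDG Φ').trans (mul_le_mul_of_nonneg_left (supN_res_le _ Φ) hcD))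
  · rw [fld_probe_mulVec_ne _ _ _ _ _ hz, siteNorm_zero]
    exact mul_nonneg hcD (supN_nonneg Φ)

end Probe

/-! ## §3. (1.10), derivative member, on a general `Ω` from the per-cube inputs -/

section Inputs

variable {ι : Type} [Fintype ι] [DecidableEq ι]

/-- the labels that can see a site number at most `2^{d+1}`. [cite: Balaban1983RegularityDecay, §2 p.575] -/
private theorem card_labelBox_le (M : ℝ) (p : Fin (d + 1) → ℝ) :
    (Fintype.piFinset fun ν => ({⌊p ν / M⌋, ⌊p ν / M⌋ + 1} : Finset ℤ)).card ≤ 2 ^ (d + 1) := by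
  rw [Fintype.card_piFinset]
  calc ∏ ν, ({⌊p ν / M⌋, ⌊p ν / M⌋ + 1} : Finset ℤ).card ≤ 2 ^ (Finset.univ : Finset (Fin (d + 1))).card :=
        Finset.prod_le_pow_card _ _ 2 fun ν _ => Finset.card_le_two
    _ = 2 ^ (d + 1) := by rw [Finset.card_univ, Fintype.card_fin]

omit [Fintype ι] [DecidableEq ι] in
/-- the unit block of `x + e_μ` is within one label of that of `x`. [folklore] -/
private theorem abs_blk_add_e1_sub_le {n : ℕ} (hn : 1 ≤ n) (x : Fin (d + 1) → ℤ) (μ ν : Fin (d + 1)) :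
    |blk n (x + e1 μ) ν - blk n x ν| ≤ 1 := by
  have hn0 : (0 : ℤ) < n := by exact_mod_cast hn
  by_cases hν : ν = μ
  · subst hν
    have h1 : (x + e1 ν) ν = x ν + 1 := by simp [B4Lower18Regular.e1_apply_self]
    show |(x + e1 ν) ν / (n : ℤ) - x ν / (n : ℤ)| ≤ 1
    rw [h1, abs_le]
    constructor
    · have := Int.ediv_le_ediv hn0 (show x ν ≤ x ν + 1 by omega)
      linarith
    · have h2 : (x ν + 1) / (n : ℤ) ≤ (x ν + 1 * (n : ℤ)) / (n : ℤ) := Int.ediv_le_ediv hn0 (by nlinarith)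
      rw [Int.add_mul_ediv_right _ _ hn0.ne'] at h2
      linarith
  · have h1 : (x + e1 μ) ν = x ν := by simp [B4Lower18Regular.e1_apply_ne hν]
    show |(x + e1 μ) ν / (n : ℤ) - x ν / (n : ℤ)| ≤ 1
    rw [h1, sub_self, abs_zero]
    exact zero_le_one

/-- **THEOREM (1.10), DERIVATIVE MEMBER, ON A GENERAL REGION `Ω` UNDER `R₀`, FROM THE PER-CUBE INPUTS** (every
structural hypothesis of r01 g6's probe chain `B4Ineq110LpChain.probe_bound_lp` DISCHARGED on [B4]'s concrete data;
setting of `B4Thm110RegionLp.thm110_value_region_of_inputs` with `Ω` a union of `K`-blocks).  INPUTS at the interior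
cubes, in the vocabulary of p35's box theorems on the translated `2K`-boxes: `‖G_k(□,Ã)Φ‖_∞ ≤ c_G‖Φ‖_∞` and
`‖D^η_{Ã,μ}G_k(□,Ã)Φ‖_∞ ≤ c_D‖Φ‖_∞` (2.17), the (2.20)/(2.21) letters `≤ c_K·…`; at every cube Lemma 2.1's
`‖·‖_{2,η}` letter on `Ω ∩ □̂_j`; `3^{d+1}√N c_K ≤ e^{−1}`.  The bond `⟨x, x + e_μ⟩ ⊂ Ω`; `R₀` in label form with
radius `K(n₀+2) + 1` (the cubes seeing `x` OR `x + e_μ` and their `n₀`-neighbours are interior).  CONCLUSION, for `f`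
supported in `P × ι` at `ℓ^∞`-distance `≥ D` (fine units) from `x` with `‖f‖_{2,η} ≤ V‖f‖_∞`:
`|(D^η_{A,μ}G_k(Ω,A)f)(x)_i| ≤ 2^{d+3}e^{19/8}·(√N c_D + (s/K)·N·max(√N c_G, 2))·V·e^{−D/(nK)}·‖f‖_∞`,
`s = (d+1)(sup|h′| + sup|h″|)` — the first-letter input by the Leibniz rule (2.3) with «|∂^ηh_j| ≤ O(M^{-1})»
(`η^{-1}|h_j(x+e_μ) − h_j(x)| ≤ s/K`, `B4Eq221HjRegion.hsizeR_hZ`), UNIFORM in `η`.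
[cite: Balaban1983RegularityDecay, Theorem (1.10) p.573; (1.3) p.572; (2.3) p.575; (2.13) p.577; (2.17)–(2.22) pp.578–579] -/
theorem thm110_deriv_region_of_inputs (F : OrthFlow ι) (κ : ℝ) {ℓ k : ℕ} (hℓ : 1 ≤ ℓ) (hk : 1 ≤ k)
    (hn : 1 ≤ (ℓ + 1) ^ k) (Ωc : Finset (Fin (d + 1) → ℤ)) {K : ℕ} (hK8 : 8 ≤ K) (hK4 : 4 ∣ K)
    (hΩ : IsBlockUnion K Ωc) {a m2 : ℝ}
    (ha : 0 < a) (hm : 0 ≤ m2) (Ac : (Fin (d + 1) → ℤ) → Fin (d + 1) → ℝ) {cG cK : ℝ} (hcG : 0 ≤ cG) (hcK : 0 ≤ cK)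
    {n₀ : ℕ} (hn₀ : 0 < n₀)
    (hG : ∀ j, cubeLabels K j ⊆ Ωc → ∀ Φ : ↥(Box d ℓ k fun _ : Fin (d + 1) => 2 * K) × ι → ℝ,
      supN (greenA d F κ ℓ k a m2 (fun _ => 2 * K) (baseEmb hn _) (stairContour hn _) (boxFld ℓ k K Ac j) *ᵥ Φ)
        ≤ cG * supN Φ)
    (h0 : ∀ j, cubeLabels K j ⊆ Ωc → ∀ Φ : ↥(Box d ℓ k fun _ : Fin (d + 1) => 2 * K) × ι → ℝ,
      supN (kOp F κ ((ℓ + 1) ^ k) (B1.aSeq a ((ℓ : ℝ) + 1) k) m2 (fun _ => 2 * K) (baseEmb hn _) (stairContour hn _)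
            (boxFld ℓ k K Ac j) (hBox ((ℓ + 1) ^ k) K (fun _ => 2 * K) (fun _ => 1))
          *ᵥ (greenA d F κ ℓ k a m2 (fun _ => 2 * K) (baseEmb hn _) (stairContour hn _) (boxFld ℓ k K Ac j)
            *ᵥ (mulH (ι := ι) (hBox ((ℓ + 1) ^ k) K (fun _ => 2 * K) (fun _ => 1)) *ᵥ Φ))) ≤ cK * supN Φ)
    (h1 : ∀ j, cubeLabels K j ⊆ Ωc → ∀ p : ℝ, 2 * (n₀ : ℝ) ≤ p →
      ∀ Φ : ↥(Box d ℓ k fun _ : Fin (d + 1) => 2 * K) × ι → ℝ,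
      supN (kOp F κ ((ℓ + 1) ^ k) (B1.aSeq a ((ℓ : ℝ) + 1) k) m2 (fun _ => 2 * K) (baseEmb hn _) (stairContour hn _)
            (boxFld ℓ k K Ac j) (hBox ((ℓ + 1) ^ k) K (fun _ => 2 * K) (fun _ => 1))
          *ᵥ (greenA d F κ ℓ k a m2 (fun _ => 2 * K) (baseEmb hn _) (stairContour hn _) (boxFld ℓ k K Ac j)
            *ᵥ (mulH (ι := ι) (hBox ((ℓ + 1) ^ k) K (fun _ => 2 * K) (fun _ => 1)) *ᵥ Φ))) ≤ cK * lpW d ℓ k p Φ)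
    (hg : ∀ j, cubeLabels K j ⊆ Ωc → ∀ p q : ℝ, 1 ≤ p → p ≤ q → p⁻¹ - q⁻¹ ≤ (2 * (n₀ : ℝ))⁻¹ →
      ∀ Φ : ↥(Box d ℓ k fun _ : Fin (d + 1) => 2 * K) × ι → ℝ,
      lpW d ℓ k q (kOp F κ ((ℓ + 1) ^ k) (B1.aSeq a ((ℓ : ℝ) + 1) k) m2 (fun _ => 2 * K) (baseEmb hn _)
            (stairContour hn _) (boxFld ℓ k K Ac j) (hBox ((ℓ + 1) ^ k) K (fun _ => 2 * K) (fun _ => 1))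
          *ᵥ (greenA d F κ ℓ k a m2 (fun _ => 2 * K) (baseEmb hn _) (stairContour hn _) (boxFld ℓ k K Ac j)
            *ᵥ (mulH (ι := ι) (hBox ((ℓ + 1) ^ k) K (fun _ => 2 * K) (fun _ => 1)) *ᵥ Φ))) ≤ cK * lpW d ℓ k p Φ)
    (hb : ∀ (j : Fin (d + 1) → ℤ) (Φ : ↥(fineDom ((ℓ + 1) ^ k) (subLabels Ωc K j)) × ι → ℝ),
      lpW d ℓ k 2 (opK (regWt ((ℓ + 1) ^ k) (fineDom ((ℓ + 1) ^ k) (subLabels Ωc K j))) m2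
            (B1.aSeq a ((ℓ : ℝ) + 1) k * (((((ℓ + 1) ^ k : ℕ)) : ℝ) ^ (d + 1))⁻¹)
            (rBlkWt ((ℓ + 1) ^ k) (subLabels Ωc K j) (fineDom ((ℓ + 1) ^ k) (subLabels Ωc K j)))
            (fieldLink F κ (acBond (subLabels Ωc K j) Ac))
            (contourTrans (fieldLink F κ (acBond (subLabels Ωc K j) Ac)) (rbaseEmb hn (subLabels Ωc K j))
              (rstairContour hn (subLabels Ωc K j)))
            (fun a : ↥(fineDom ((ℓ + 1) ^ k) (subLabels Ωc K j)) => hZ ((ℓ + 1) ^ k) K j a.1)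
          *ᵥ ((covOp (regWt ((ℓ + 1) ^ k) (fineDom ((ℓ + 1) ^ k) (subLabels Ωc K j))) m2
                (B1.aSeq a ((ℓ : ℝ) + 1) k * (((((ℓ + 1) ^ k : ℕ)) : ℝ) ^ (d + 1))⁻¹)
                (rBlkWt ((ℓ + 1) ^ k) (subLabels Ωc K j) (fineDom ((ℓ + 1) ^ k) (subLabels Ωc K j)))
                (fieldLink F κ (acBond (subLabels Ωc K j) Ac))
                (contourTrans (fieldLink F κ (acBond (subLabels Ωc K j) Ac)) (rbaseEmb hn (subLabels Ωc K j))
                  (rstairContour hn (subLabels Ωc K j))))⁻¹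
            *ᵥ (mulH (ι := ι) (fun a : ↥(fineDom ((ℓ + 1) ^ k) (subLabels Ωc K j)) => hZ ((ℓ + 1) ^ k) K j a.1)
              *ᵥ Φ))) ≤ cK * lpW d ℓ k 2 Φ)
    {cD : ℝ} (hcD : 0 ≤ cD) (μ : Fin (d + 1))
    (hDG : ∀ j, cubeLabels K j ⊆ Ωc → ∀ Φ : ↥(Box d ℓ k fun _ : Fin (d + 1) => 2 * K) × ι → ℝ,
      supN (derivA d F κ ℓ k (fun _ => 2 * K) (boxFld ℓ k K Ac j) μ
        *ᵥ (greenA d F κ ℓ k a m2 (fun _ => 2 * K) (baseEmb hn _) (stairContour hn _) (boxFld ℓ k K Ac j) *ᵥ Φ))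
        ≤ cD * supN Φ)
    (h3 : (3 : ℝ) ^ (d + 1) * (Real.sqrt (Fintype.card ι) * cK) ≤ Real.exp (-1))
    (x : ↥(fineDom ((ℓ + 1) ^ k) Ωc)) (hxμ : x.1 + e1 μ ∈ fineDom ((ℓ + 1) ^ k) Ωc)
    (hR₀ : ∀ y : Fin (d + 1) → ℤ, (∀ ν, |y ν - blk ((ℓ + 1) ^ k) x.1 ν| ≤ (K : ℤ) * (n₀ + 2) + 1) → y ∈ Ωc)
    (P : ↥(fineDom ((ℓ + 1) ^ k) Ωc) → Prop) [DecidablePred P] {D : ℝ}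
    (hD : ∀ x', P x' → ∃ ν, D ≤ |rpos ((ℓ + 1) ^ k) Ωc x ν - rpos ((ℓ + 1) ^ k) Ωc x' ν|)
    (f : ↥(fineDom ((ℓ + 1) ^ k) Ωc) × ι → ℝ) (hfP : ∀ p, ¬ P p.1 → f p = 0) {V : ℝ} (hV : 1 ≤ V)
    (hfV : lpv (vol d ℓ k)⁻¹ 2 f ≤ V * ‖f‖) (i : ι) :
    |(covDeriv ((ℓ + 1) ^ k) (fineDom ((ℓ + 1) ^ k) Ωc) (fieldLink F κ (acBond Ωc Ac)) μ
        *ᵥ ((covOp (regWt ((ℓ + 1) ^ k) (fineDom ((ℓ + 1) ^ k) Ωc)) m2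
          (B1.aSeq a ((ℓ : ℝ) + 1) k * (((((ℓ + 1) ^ k : ℕ)) : ℝ) ^ (d + 1))⁻¹)
          (rBlkWt ((ℓ + 1) ^ k) Ωc (fineDom ((ℓ + 1) ^ k) Ωc)) (fieldLink F κ (acBond Ωc Ac))
          (contourTrans (fieldLink F κ (acBond Ωc Ac)) (rbaseEmb hn Ωc) (rstairContour hn Ωc)))⁻¹ *ᵥ f)) (x, i)|
      ≤ 2 ^ (d + 3) * Real.exp (19 / 8)
          * (Real.sqrt (Fintype.card ι) * cD
              + ((d : ℝ) + 1) * (D1 hprof + D2 hprof) / K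
                  * ((Fintype.card ι : ℝ) * max (Real.sqrt (Fintype.card ι) * cG) 2))
          * V * Real.exp (-(D / ((((ℓ + 1) ^ k : ℕ) : ℝ) * K))) * ‖f‖ := by
  classical
  have hK1 : 1 ≤ K := le_trans (by norm_num) hK8
  have hn2 : 2 ≤ (ℓ + 1) ^ k := by
    calc 2 ≤ ℓ + 1 := by omega
      _ = (ℓ + 1) ^ 1 := (pow_one _).symm
      _ ≤ (ℓ + 1) ^ k := Nat.pow_le_pow_right (Nat.succ_pos ℓ) hk
  have hnK3 : 3 ≤ (ℓ + 1) ^ k * K := le_trans (by norm_num) (Nat.mul_le_mul hn2 hK8)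
  have hnr : (1 : ℝ) ≤ ((((ℓ + 1) ^ k : ℕ)) : ℝ) := by exact_mod_cast hn
  have hn0 : (0 : ℝ) < ((((ℓ + 1) ^ k : ℕ)) : ℝ) := by positivity
  have hKr : (1 : ℝ) ≤ K := by exact_mod_cast hK1
  have hKpos : (0 : ℝ) < K := by positivity
  have hM : (0 : ℝ) < ((((ℓ + 1) ^ k : ℕ)) : ℝ) * K := by positivity
  have hL : (1 : ℝ) < (ℓ : ℝ) + 1 := by
    have : (1 : ℝ) ≤ ℓ := by exact_mod_cast hℓ
    linarith
  have hak : 0 < B1.aSeq a ((ℓ : ℝ) + 1) k := B1.aSeq_pos ha hL hk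
  have hak' : 0 < B1.aSeq a ((ℓ : ℝ) + 1) k * (((((ℓ + 1) ^ k : ℕ)) : ℝ) ^ (d + 1))⁻¹ := by positivity
  have hw : (0 : ℝ) < (vol d ℓ k)⁻¹ := inv_pos.2 (vol_pos d ℓ k)
  have hN : (0 : ℝ) ≤ Real.sqrt (Fintype.card ι) := Real.sqrt_nonneg _
  have hs0 : 0 ≤ ((d : ℝ) + 1) * (D1 hprof + D2 hprof) := by
    have := D1_nonneg contDiff_hprof hasCompactSupport_hprof
    have := D2_nonneg contDiff_hprof hasCompactSupport_hprof
    positivity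
  -- the four chain inputs
  obtain ⟨Hγ, H0, Hgr, H2⟩ := chain_letter_inputs F κ hℓ hk hn Ωc hK8 ha hm Ac hcG hcK hn₀ hG h0 h1 hg hb
  -- the bond `⟨x, y⟩`
  set y : ↥(fineDom ((ℓ + 1) ^ k) Ωc) := ⟨x.1 + e1 μ, hxμ⟩ with hy
  have hyn : y.1 ∈ nbrs x.1 := mem_nbrs.2 ⟨μ, Or.inl rfl⟩
  have hxy : ∀ ν, |rpos ((ℓ + 1) ^ k) Ωc x ν - rpos ((ℓ + 1) ^ k) Ωc y ν| ≤ 1 / 8 * ((((ℓ + 1) ^ k : ℕ) : ℝ) * K) := by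
    refine regWt_local hn Ωc hK8 x y ?_
    unfold regWt
    rw [if_pos hyn, mul_one]
    positivity
  -- abbreviations
  set hh : (Fin (d + 1) → ℤ) → ↥(fineDom ((ℓ + 1) ^ k) Ωc) → ℝ :=
    fun j z => hCube ((((ℓ + 1) ^ k : ℕ) : ℝ) * K) j (rpos ((ℓ + 1) ^ k) Ωc z) with hhh
  have hh_abs : ∀ j z, |hh j z| ≤ 1 := fun j z => by
    rw [hhh, abs_of_nonneg (hCube_nonneg _ _ _)]; exact hCube_le_one _ _ _
  set Wxy : Matrix ι ι ℝ := fieldLink F κ (acBond Ωc Ac) x y with hWxy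
  set Pr : Matrix (↥(fineDom ((ℓ + 1) ^ k) Ωc) × ι) (↥(fineDom ((ℓ + 1) ^ k) Ωc) × ι) ℝ :=
    ((((ℓ + 1) ^ k : ℕ)) : ℝ) • (unitOp x y Wxy - unitOp x x (1 : Matrix ι ι ℝ)) with hPr
  have hwN : ∀ k', ∑ k'', |Wxy k' k''| ≤ (Fintype.card ι : ℝ) := fun k' => row_abs_sum_U_le F _ k'
  set s := labels ((((ℓ + 1) ^ k : ℕ) : ℝ) * K) ((ℓ + 1) ^ k) Ωc with hs_def
  -- the starting cubes: those seeing `x` or `y`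
  set S₀ : Finset ↥s := Finset.univ.filter fun j => hh j.1 x ≠ 0 ∨ hh j.1 y ≠ 0 with hS₀
  have hcard : S₀.card ≤ 2 ^ (d + 2) := by
    have hsub : S₀.map (Function.Embedding.subtype (· ∈ s))
        ⊆ (Fintype.piFinset fun ν => ({⌊rpos ((ℓ + 1) ^ k) Ωc x ν / (((((ℓ + 1) ^ k : ℕ)) : ℝ) * K)⌋,
            ⌊rpos ((ℓ + 1) ^ k) Ωc x ν / (((((ℓ + 1) ^ k : ℕ)) : ℝ) * K)⌋ + 1} : Finset ℤ))
          ∪ (Fintype.piFinset fun ν => ({⌊rpos ((ℓ + 1) ^ k) Ωc y ν / (((((ℓ + 1) ^ k : ℕ)) : ℝ) * K)⌋,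
            ⌊rpos ((ℓ + 1) ^ k) Ωc y ν / (((((ℓ + 1) ^ k : ℕ)) : ℝ) * K)⌋ + 1} : Finset ℤ)) := by
      intro j hj
      obtain ⟨i', hi', rfl⟩ := Finset.mem_map.mp hj
      obtain ⟨-, hixy⟩ := Finset.mem_filter.mp hi'
      rcases hixy with hix | hiy
      · exact Finset.mem_union_left _ (mem_box_of_hCube_ne_zero hix)
      · exact Finset.mem_union_right _ (mem_box_of_hCube_ne_zero hiy)
    calc S₀.card = (S₀.map (Function.Embedding.subtype (· ∈ s))).card := (Finset.card_map _).symm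
      _ ≤ _ := Finset.card_le_card hsub
      _ ≤ _ := Finset.card_union_le _ _
      _ ≤ 2 ^ (d + 1) + 2 ^ (d + 1) := add_le_add (card_labelBox_le _ _) (card_labelBox_le _ _)
      _ = 2 ^ (d + 2) := by ring
  have hP0 : ∀ j : ↥s, j ∉ S₀ → Pr * mulH (ι := ι) (hh j.1) = 0 := by
    intro j hj
    have hjx : hh j.1 x = 0 := by
      by_contra h0'; exact hj (Finset.mem_filter.mpr ⟨Finset.mem_univ _, Or.inl h0'⟩)
    have hjy : hh j.1 y = 0 := by
      by_contra h0'; exact hj (Finset.mem_filter.mpr ⟨Finset.mem_univ _, Or.inr h0'⟩)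
    rw [hPr, probe_mul_mulH, hjx, hjy, sub_zero, mul_zero, zero_smul, zero_smul, add_zero]
  -- the cubes seeing `x` or `y` contain both in their `¾M`-core
  have hcore : ∀ j : Fin (d + 1) → ℤ, (hh j x ≠ 0 ∨ hh j y ≠ 0) →
      (∀ ν, |rpos ((ℓ + 1) ^ k) Ωc x ν - ((((ℓ + 1) ^ k : ℕ) : ℝ) * K) * j ν|
        < 3 / 4 * ((((ℓ + 1) ^ k : ℕ) : ℝ) * K)) ∧
      (∀ ν, |rpos ((ℓ + 1) ^ k) Ωc y ν - ((((ℓ + 1) ^ k : ℕ) : ℝ) * K) * j ν|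
        ≤ 3 / 4 * ((((ℓ + 1) ^ k : ℕ) : ℝ) * K)) := by
    intro j hj
    rcases hj with hjx | hjy
    · refine ⟨fun ν => (hCube_ne_zero_imp hM hjx ν).trans (by nlinarith), fun ν => ?_⟩
      have h1 := hCube_ne_zero_imp hM hjx ν
      have h2 := hxy ν
      rw [abs_sub_comm] at h2
      calc |rpos ((ℓ + 1) ^ k) Ωc y ν - ((((ℓ + 1) ^ k : ℕ) : ℝ) * K) * j ν|
          ≤ |rpos ((ℓ + 1) ^ k) Ωc y ν - rpos ((ℓ + 1) ^ k) Ωc x ν|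
            + |rpos ((ℓ + 1) ^ k) Ωc x ν - ((((ℓ + 1) ^ k : ℕ) : ℝ) * K) * j ν| := abs_sub_le _ _ _
        _ ≤ 1 / 8 * ((((ℓ + 1) ^ k : ℕ) : ℝ) * K) + 5 / 8 * ((((ℓ + 1) ^ k : ℕ) : ℝ) * K) := add_le_add h2 h1.le
        _ = 3 / 4 * ((((ℓ + 1) ^ k : ℕ) : ℝ) * K) := by ring
    · refine ⟨fun ν => ?_, fun ν => (hCube_ne_zero_imp hM hjy ν).le.trans (by nlinarith)⟩
      have h1 := hCube_ne_zero_imp hM hjy ν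
      have h2 := hxy ν
      calc |rpos ((ℓ + 1) ^ k) Ωc x ν - ((((ℓ + 1) ^ k : ℕ) : ℝ) * K) * j ν|
          ≤ |rpos ((ℓ + 1) ^ k) Ωc x ν - rpos ((ℓ + 1) ^ k) Ωc y ν|
            + |rpos ((ℓ + 1) ^ k) Ωc y ν - ((((ℓ + 1) ^ k : ℕ) : ℝ) * K) * j ν| := abs_sub_le _ _ _
        _ < 1 / 8 * ((((ℓ + 1) ^ k : ℕ) : ℝ) * K) + 5 / 8 * ((((ℓ + 1) ^ k : ℕ) : ℝ) * K) :=
            add_lt_add_of_le_of_lt h2 h1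
        _ = 3 / 4 * ((((ℓ + 1) ^ k : ℕ) : ℝ) * K) := by ring
  have hS₀ρ : ∀ j ∈ S₀, ∀ ν, |rpos ((ℓ + 1) ^ k) Ωc x ν - ((((ℓ + 1) ^ k : ℕ) : ℝ) * K) * j.1 ν|
      < 3 / 4 * ((((ℓ + 1) ^ k : ℕ) : ℝ) * K) := fun j hj => (hcore j.1 (Finset.mem_filter.mp hj).2).1
  -- `R₀`: the cubes seeing `x` or `y` and their `n₀`-neighbours are interior
  have hRx : ∀ y' : Fin (d + 1) → ℤ, (∀ ν, |y' ν - blk ((ℓ + 1) ^ k) x.1 ν| ≤ (K : ℤ) * (n₀ + 2)) → y' ∈ Ωc :=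
    fun y' hy' => hR₀ y' fun ν => (hy' ν).trans (by linarith)
  have hRy : ∀ y' : Fin (d + 1) → ℤ, (∀ ν, |y' ν - blk ((ℓ + 1) ^ k) y.1 ν| ≤ (K : ℤ) * (n₀ + 2)) → y' ∈ Ωc := by
    intro y' hy'
    refine hR₀ y' fun ν => ?_
    have h1 := hy' ν
    have h2 := abs_blk_add_e1_sub_le hn x.1 μ ν
    calc |y' ν - blk ((ℓ + 1) ^ k) x.1 ν|
        = |(y' ν - blk ((ℓ + 1) ^ k) y.1 ν) + (blk ((ℓ + 1) ^ k) (x.1 + e1 μ) ν - blk ((ℓ + 1) ^ k) x.1 ν)| := by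
          rw [hy]; ring_nf
      _ ≤ |y' ν - blk ((ℓ + 1) ^ k) y.1 ν| + |blk ((ℓ + 1) ^ k) (x.1 + e1 μ) ν - blk ((ℓ + 1) ^ k) x.1 ν| :=
          abs_add_le _ _
      _ ≤ (K : ℤ) * (n₀ + 2) + 1 := add_le_add h1 h2
  have hgood : ∀ j : Fin (d + 1) → ℤ, (hh j x ≠ 0 ∨ hh j y ≠ 0) → ∀ l : Fin (d + 1) → ℤ,
      (∀ ν, |j ν - l ν| ≤ (n₀ : ℤ)) → cubeLabels K l ⊆ Ωc := by
    intro j hj l hjl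
    rcases hj with hjx | hjy
    · exact good_of_R0 ℓ k Ωc hK8 n₀ x hRx j hjx l hjl
    · exact good_of_R0 ℓ k Ωc hK8 n₀ y hRy j hjy l hjl
  have hgoodS₀ : ∀ j ∈ S₀, cubeLabels K j.1 ⊆ Ωc := fun j hj =>
    hgood j.1 (Finset.mem_filter.mp hj).2 j.1 fun ν => by simp
  have hR₀' : ∀ j ∈ S₀, ∀ l : ↥s, (∀ ν, |j.1 ν - l.1 ν| ≤ (n₀ : ℤ)) → cubeLabels K l.1 ⊆ Ωc :=
    fun j hj l hjl => hgood j.1 (Finset.mem_filter.mp hj).2 l.1 hjl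
  -- the first-letter input `α_P` by the Leibniz rule (2.3)
  set γ : ℝ := max (Real.sqrt (Fintype.card ι) * cG) 2 with hγ
  have hγ0 : 0 ≤ γ := le_max_of_le_right zero_le_two
  set αP : ℝ := Real.sqrt (Fintype.card ι) * cD
    + ((d : ℝ) + 1) * (D1 hprof + D2 hprof) / K * ((Fintype.card ι : ℝ) * γ) with hαP
  have hαP0 : 0 ≤ αP := by positivity
  have hαPj : ∀ j ∈ S₀, ‖Pr * (mulH (ι := ι) (hh j.1) * atGreen F κ ℓ k Ωc K Ac a m2 j.1
      * mulH (ι := ι) (hh j.1))‖ ≤ αP := by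
    intro j hj
    have hgj := hgoodS₀ j hj
    have hsee := (Finset.mem_filter.mp hj).2
    have hpl := hcore j.1 hsee
    have hMh : ‖mulH (ι := ι) (hh j.1)‖ ≤ 1 := norm_mulH_le _ zero_le_one (hh_abs j.1)
    have hGn : ‖atGreen F κ ℓ k Ωc K Ac a m2 j.1‖ ≤ γ := Hγ j.1 hgj
    have hE : ‖unitOp x y Wxy‖ ≤ (Fintype.card ι : ℝ) := norm_unitOp_le x y Wxy (Nat.cast_nonneg _) hwN
    -- «|∂^ηh_j| ≤ O(M^{-1})»: `η^{-1}|h_j(y) − h_j(x)| ≤ s/K`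
    have hgrad : |((((ℓ + 1) ^ k : ℕ)) : ℝ) * (hh j.1 y - hh j.1 x)|
        ≤ ((d : ℝ) + 1) * (D1 hprof + D2 hprof) / K := by
      rw [abs_mul, abs_of_pos hn0]
      have h1 := (hsizeR_hZ hn hnK3 hΩ j.1).grad_le x y hyn
      simp only [hhh, hCube_rpos_eq_hZ] at h1 ⊢
      exact h1
    -- the first Leibniz term
    have hfirst : |hh j.1 x| * ‖Pr * atGreen F κ ℓ k Ωc K Ac a m2 j.1 * mulH (ι := ι) (hh j.1)‖
        ≤ Real.sqrt (Fintype.card ι) * cD := by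
      have hPG : ‖Pr * atGreen F κ ℓ k Ωc K Ac a m2 j.1‖ ≤ Real.sqrt (Fintype.card ι) * cD :=
        probe_atGreen_le F κ hn Ωc hK1 Ac a m2 hgj μ x hxμ (fun ν => (hpl.1 ν).le) hpl.2 hcD (hDG j.1 hgj)
      calc |hh j.1 x| * ‖Pr * atGreen F κ ℓ k Ωc K Ac a m2 j.1 * mulH (ι := ι) (hh j.1)‖
          ≤ 1 * (‖Pr * atGreen F κ ℓ k Ωc K Ac a m2 j.1‖ * ‖mulH (ι := ι) (hh j.1)‖) :=
            mul_le_mul (hh_abs j.1 x) (norm_mul_le _ _) (norm_nonneg _) zero_le_one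
        _ ≤ 1 * (Real.sqrt (Fintype.card ι) * cD * 1) := by
            refine mul_le_mul_of_nonneg_left (mul_le_mul hPG hMh (norm_nonneg _) (by positivity)) zero_le_one
        _ = Real.sqrt (Fintype.card ι) * cD := by ring
    have hsecond : |((((ℓ + 1) ^ k : ℕ)) : ℝ) * (hh j.1 y - hh j.1 x)|
        * ‖unitOp x y Wxy * atGreen F κ ℓ k Ωc K Ac a m2 j.1 * mulH (ι := ι) (hh j.1)‖
        ≤ ((d : ℝ) + 1) * (D1 hprof + D2 hprof) / K * ((Fintype.card ι : ℝ) * γ) := by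
      refine mul_le_mul hgrad ?_ (norm_nonneg _) (by positivity)
      calc ‖unitOp x y Wxy * atGreen F κ ℓ k Ωc K Ac a m2 j.1 * mulH (ι := ι) (hh j.1)‖
          ≤ ‖unitOp x y Wxy‖ * ‖atGreen F κ ℓ k Ωc K Ac a m2 j.1‖ * ‖mulH (ι := ι) (hh j.1)‖ :=
            (norm_mul_le _ _).trans (mul_le_mul_of_nonneg_right (norm_mul_le _ _) (norm_nonneg _))
        _ ≤ (Fintype.card ι : ℝ) * γ * 1 :=
            mul_le_mul (mul_le_mul hE hGn (norm_nonneg _) (Nat.cast_nonneg _)) hMh (norm_nonneg _)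
              (by positivity)
        _ = (Fintype.card ι : ℝ) * γ := mul_one _
    have hsplit : Pr * (mulH (ι := ι) (hh j.1) * atGreen F κ ℓ k Ωc K Ac a m2 j.1 * mulH (ι := ι) (hh j.1))
        = hh j.1 x • (Pr * atGreen F κ ℓ k Ωc K Ac a m2 j.1 * mulH (ι := ι) (hh j.1))
          + (((((ℓ + 1) ^ k : ℕ)) : ℝ) * (hh j.1 y - hh j.1 x))
              • (unitOp x y Wxy * atGreen F κ ℓ k Ωc K Ac a m2 j.1 * mulH (ι := ι) (hh j.1)) := by
      rw [show Pr * (mulH (ι := ι) (hh j.1) * atGreen F κ ℓ k Ωc K Ac a m2 j.1 * mulH (ι := ι) (hh j.1))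
          = Pr * mulH (ι := ι) (hh j.1) * atGreen F κ ℓ k Ωc K Ac a m2 j.1 * mulH (ι := ι) (hh j.1) by
            simp only [Matrix.mul_assoc],
        hPr, probe_mul_mulH]
      simp only [Matrix.add_mul, Matrix.smul_mul]
    rw [hsplit]
    refine (norm_add_le _ _).trans ?_
    rw [norm_smul, norm_smul, Real.norm_eq_abs, Real.norm_eq_abs, hαP]
    exact add_le_add hfirst hsecond
  -- THE PROBE CHAIN
  have main := probe_bound_lp (X := ↥(fineDom ((ℓ + 1) ^ k) Ωc)) (Y := ↥Ωc) (κ := ι) hM (rpos ((ℓ + 1) ^ k) Ωc)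
    (regWt ((ℓ + 1) ^ k) (fineDom ((ℓ + 1) ^ k) Ωc)) m2
    (B1.aSeq a ((ℓ : ℝ) + 1) k * ((((((ℓ + 1) ^ k : ℕ)) : ℝ)) ^ (d + 1))⁻¹)
    (rBlkWt ((ℓ + 1) ^ k) Ωc (fineDom ((ℓ + 1) ^ k) Ωc)) (fieldLink F κ (acBond Ωc Ac))
    (contourTrans (fieldLink F κ (acBond Ωc Ac)) (rbaseEmb hn Ωc) (rstairContour hn Ωc))
    (fun x z' h μ => regWt_local hn Ωc hK8 x z' h μ)
    (fun y x z' h h' μ => rBlkWt_local hn Ωc hK8 y x z' h h' μ)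
    s (fun j z h => labels_complete Ωc _ j z h)
    (fun j => cubeS ℓ k Ωc K j) (fun j z hz => inBox_of_near hn hK1 j z hz)
    (fun j => cubeW F κ ℓ k Ωc K (atField ℓ k Ωc K Ac j) j)
    (fun j => cubeT F κ ℓ k Ωc K (atField ℓ k Ωc K Ac j) j)
    (fun j x z' hx hz' => cubeW_window F κ ℓ k Ωc hK1 j hx hz' (atField_core ℓ k Ωc Ac hK1 j x z' hx hz'))
    (fun j y x hyx hx => cubeT_window F κ ℓ k Ωc hK1 hK4 j
      (fun u v hu hv _ => atField_core ℓ k Ωc Ac hK1 j u v hu hv) y x hyx hx)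
    (atGreen F κ ℓ k Ωc K Ac a m2)
    (fun j _ => atGreen_mul F κ ℓ k Ωc K Ac hℓ hk ha hm j)
    _ (green_mul_op hn Ωc F κ hak' hm (regWt ((ℓ + 1) ^ k) (fineDom ((ℓ + 1) ^ k) Ωc)) (regWt_nonneg _ _)
      (fun _ _ _ => rfl) (acBond Ωc Ac))
    Pr S₀ (m₀ := 2 ^ (d + 2)) hcard hP0 x (ρ := 3 / 4) hS₀ρ
    (fun j => cubeLabels K j ⊆ Ωc) (β := Real.sqrt (Fintype.card ι) * cK) (w := (vol d ℓ k)⁻¹)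
    hn₀ hw hαP0 (by positivity) hαPj
    (fun jj hj => H0 jj.1 hj) (fun jj hj => Hgr jj.1 hj) (fun jj g => H2 jj.1 g)
    h3 hR₀' P hD f hfP hV hfV
  -- the entry `(x, i)` of `P·G_k(Ω,A)f` is `(D^η_{A,μ}G_k(Ω,A)f)(x)_i`
  set G := (covOp (regWt ((ℓ + 1) ^ k) (fineDom ((ℓ + 1) ^ k) Ωc)) m2
      (B1.aSeq a ((ℓ : ℝ) + 1) k * ((((((ℓ + 1) ^ k : ℕ)) : ℝ)) ^ (d + 1))⁻¹)
      (rBlkWt ((ℓ + 1) ^ k) Ωc (fineDom ((ℓ + 1) ^ k) Ωc)) (fieldLink F κ (acBond Ωc Ac))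
      (contourTrans (fieldLink F κ (acBond Ωc Ac)) (rbaseEmb hn Ωc) (rstairContour hn Ωc)))⁻¹ with hGdef
  have hentry : (covDeriv ((ℓ + 1) ^ k) (fineDom ((ℓ + 1) ^ k) Ωc) (fieldLink F κ (acBond Ωc Ac)) μ
      *ᵥ (G *ᵥ f)) (x, i) = (Pr *ᵥ (G *ᵥ f)) (x, i) := by
    have h1 := fld_covDeriv_mulVec_of_mem ((ℓ + 1) ^ k) (fieldLink F κ (acBond Ωc Ac)) (G *ᵥ f) (μ := μ) hxμ
    have h2 := fld_probe_mulVec_self x y Wxy ((((ℓ + 1) ^ k : ℕ)) : ℝ) (G *ᵥ f)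
    have h12 := h1.trans h2.symm
    exact congrFun h12 i
  rw [hentry, ← Real.norm_eq_abs]
  refine (norm_le_pi_norm _ (x, i)).trans (main.trans (le_of_eq ?_))
  rw [show (3 : ℝ) / 4 + 13 / 8 = 19 / 8 by norm_num, hαP]
  push_cast
  ring

end Inputs

/-! ## §4. THE THEOREM (1.10), derivative member, for a general `Ω` under `R₀` — hypothesis-free -/

section Main

variable {ι : Type} [Fintype ι] [DecidableEq ι]

/-- **THEOREM p. 573, INEQUALITY (1.10) — DERIVATIVE member — FOR A GENERAL REGION `Ω` UNDER THE `R₀` RESTRICTION,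
for a (1.7)-regular vector field, with only «e sufficiently small», UNIFORM IN `η`** (the print's own route as in
`B4Thm110RegionLp.thm110_value_region`, the probe `D^η_{A,μ}` at `x` handled by (2.3) and «|∂^ηh_j| ≤ O(M^{-1})»,
Lemma 2.2 (2.17) for `D^η_{Ã,μ}G_k(□,Ã)` at the interior cubes).  There are a cube size `K ≥ 8` (`8 ∣ K`) and `c₀ > 0`
(depending on `d`, `N`, the flow, `L` and the windows only) such that for every `(c, β)`, `β > 0`, there is `e₁ > 0`
with: for every step `k ≥ 1`, `a ∈ [a₋, a₊]`, `0 ≤ m² ≤ m₊²`, every finite union `Ω` of `K`-blocks, every `A` regular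
(1.7) on `Ω` with `0 < e ≤ e₁`, every direction `μ` and site `x` with `x, x + e_μ ∈ Ω` and every unit label within
`K(d+3) + 1` of the block of `x` in `Ω` (the `R₀` restriction, label form), every `f` supported at `ℓ^∞`-distance `≥ D`
(fine units) from `x` with `‖f‖_{2,η} ≤ V‖f‖_∞`, and every colour `i`:
`|(D^η_{A,μ}G_k(Ω,A)f)(x)_i| ≤ c₀·V·exp(−D/(nK))·‖f‖_∞` (`D^η_{A,μ} = B4Lemma21Region.regionDeriv`, the factor
`η^{-1}` included). [cite: Balaban1983RegularityDecay, Theorem p.573 (1.10); (1.3) p.572; §2 pp.575–579 (2.2)–(2.22)] -/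
theorem thm110_deriv_region (F : OrthFlow ι) {ℓ₁ : ℝ} (hℓ₁ : 0 ≤ ℓ₁)
    (hLip : ∀ t (v : ι → ℝ), ((F.U t - 1) *ᵥ v) ⬝ᵥ ((F.U t - 1) *ᵥ v) ≤ (ℓ₁ * t) ^ 2 * (v ⬝ᵥ v))
    (d ℓ : ℕ) (hℓ : 1 ≤ ℓ) (amin aplus m2plus : ℝ) (ha : 0 < amin) :
    ∃ K : ℕ, 8 ≤ K ∧ 8 ∣ K ∧ ∃ c₀ : ℝ, 0 < c₀ ∧ ∀ (creg β : ℝ), 0 ≤ creg → 0 < β →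
      ∃ e₁ : ℝ, 0 < e₁ ∧ ∀ (k : ℕ), 1 ≤ k → ∀ (hn : 1 ≤ (ℓ + 1) ^ k) (a m2 : ℝ),
      amin ≤ a → a ≤ aplus → 0 ≤ m2 → m2 ≤ m2plus →
      ∀ (Ωc : Finset (Fin (d + 1) → ℤ)), IsBlockUnion K Ωc →
      ∀ (Ac : (Fin (d + 1) → ℤ) → Fin (d + 1) → ℝ) (e : ℝ), 0 < e → e ≤ e₁ →
        (∀ x ∈ fineDom ((ℓ + 1) ^ k) Ωc, ∀ μ ν : Fin (d + 1),
          |Ac (x + e1 μ) ν - Ac x ν| ≤ creg * e ^ (β - 1) / ((ℓ + 1) ^ k : ℕ)) →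
      ∀ (μ : Fin (d + 1)) (x : ↥(fineDom ((ℓ + 1) ^ k) Ωc)), x.1 + e1 μ ∈ fineDom ((ℓ + 1) ^ k) Ωc →
        (∀ y : Fin (d + 1) → ℤ, (∀ ν, |y ν - blk ((ℓ + 1) ^ k) x.1 ν| ≤ (K : ℤ) * (d + 3) + 1) → y ∈ Ωc) →
      ∀ (P : ↥(fineDom ((ℓ + 1) ^ k) Ωc) → Prop) [DecidablePred P] (D : ℝ),
        (∀ x', P x' → ∃ ν, D ≤ |rpos ((ℓ + 1) ^ k) Ωc x ν - rpos ((ℓ + 1) ^ k) Ωc x' ν|) →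
      ∀ (f : ↥(fineDom ((ℓ + 1) ^ k) Ωc) × ι → ℝ), (∀ p, ¬ P p.1 → f p = 0) →
      ∀ (V : ℝ), 1 ≤ V → lpv (vol d ℓ k)⁻¹ 2 f ≤ V * ‖f‖ →
      ∀ i : ι,
        |(regionDeriv F e ((ℓ + 1) ^ k) Ωc Ac μ
            *ᵥ ((regionOp F e hn (B1.aSeq a ((ℓ : ℝ) + 1) k) m2 Ωc Ac)⁻¹ *ᵥ f)) (x, i)|
          ≤ c₀ * V * Real.exp (-(D / ((((ℓ + 1) ^ k : ℕ) : ℝ) * K))) * ‖f‖ := by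
  -- the constants of the per-cube inputs (Lemma 2.2 at `Ã_j`, (2.20), (2.21), the graded factor; Lemma 2.1)
  obtain ⟨C₁, hC₁, h₁⟩ := lemma22_sup_cubeField F hℓ₁ hLip d ℓ hℓ amin aplus m2plus ha
  obtain ⟨C₂, hC₂, h₂⟩ := eq220_cubeField_std F hℓ₁ hLip d ℓ hℓ amin aplus m2plus ha
  have hp₁ : (d : ℝ) + 1 < 2 * ((d : ℝ) + 1) := by
    have : (0 : ℝ) ≤ d := Nat.cast_nonneg d
    linarith
  obtain ⟨C₃, hC₃, h₃⟩ := eq221_cubeField F hℓ₁ hLip d ℓ hℓ amin aplus m2plus ha hp₁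
  obtain ⟨C₄, hC₄, h₄⟩ := eq221_psup_cubeField_std F hℓ₁ hLip d ℓ hℓ amin aplus m2plus ha hp₁
  have hs : 0 ≤ ((d : ℝ) + 1) * (D1 hprof + D2 hprof) := by
    have := D1_nonneg contDiff_hprof hasCompactSupport_hprof
    have := D2_nonneg contDiff_hprof hasCompactSupport_hprof
    positivity
  have hγ₀ : 0 < min 2 (3 / 4 * amin) / 4 := div_pos (lt_min two_pos (by linarith)) four_pos
  set C₅ : ℝ := (2 * ((d : ℝ) + 1) * (Real.sqrt (min 2 (3 / 4 * amin) / 4))⁻¹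
      + (1 + |aplus|) * (min 2 (3 / 4 * amin) / 4)⁻¹) * (((d : ℝ) + 1) * (D1 hprof + D2 hprof)) with hC₅
  have hC₅0 : 0 ≤ C₅ := by
    have : 0 ≤ (Real.sqrt (min 2 (3 / 4 * amin) / 4))⁻¹ := inv_nonneg.2 (Real.sqrt_nonneg _)
    have : 0 ≤ (min 2 (3 / 4 * amin) / 4)⁻¹ := inv_nonneg.2 hγ₀.le
    positivity
  set Cm : ℝ := C₂ + C₃ + C₄ + C₅ with hCm
  have hCm0 : 0 ≤ Cm := by positivity
  -- the cube size: `3^{d+1}·√N·C_max/K ≤ e^{−1}`, `8 ∣ K`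
  set X : ℝ := (3 : ℝ) ^ (d + 1) * Real.sqrt (Fintype.card ι) * Cm * Real.exp 1 with hX
  have hX0 : 0 ≤ X := by positivity
  set K : ℕ := 8 * (⌈X⌉₊ + 1) with hK
  have hK8 : 8 ≤ K := by omega
  have h8 : 8 ∣ K := ⟨⌈X⌉₊ + 1, rfl⟩
  have hK4 : 4 ∣ K := ⟨2 * (⌈X⌉₊ + 1), by omega⟩
  have hK2 : 2 ≤ K := by omega
  have hK1 : 1 ≤ K := by omega
  have hKr : (0 : ℝ) < K := by exact_mod_cast hK1
  have hKX : X ≤ K := by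
    refine (Nat.le_ceil X).trans ?_
    rw [hK]
    push_cast
    linarith [(Nat.cast_nonneg ⌈X⌉₊ : (0 : ℝ) ≤ ⌈X⌉₊)]
  set cK : ℝ := Cm / K with hcK_def
  have hcK : 0 ≤ cK := div_nonneg hCm0 hKr.le
  have h3 : (3 : ℝ) ^ (d + 1) * (Real.sqrt (Fintype.card ι) * cK) ≤ Real.exp (-1) := by
    have hexp : Real.exp 1 * Real.exp (-1) = 1 := by rw [← Real.exp_add]; norm_num
    have e : (3 : ℝ) ^ (d + 1) * (Real.sqrt (Fintype.card ι) * cK) = X / K * Real.exp (-1) := by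
      rw [hcK_def, hX]
      calc (3 : ℝ) ^ (d + 1) * (Real.sqrt (Fintype.card ι) * (Cm / K))
          = (3 : ℝ) ^ (d + 1) * Real.sqrt (Fintype.card ι) * Cm / K * (Real.exp 1 * Real.exp (-1)) := by
            rw [hexp]; ring
        _ = (3 : ℝ) ^ (d + 1) * Real.sqrt (Fintype.card ι) * Cm * Real.exp 1 / K * Real.exp (-1) := by ring
    rw [e]
    have : X / K ≤ 1 := div_le_one_of_le₀ hKX (Nat.cast_nonneg K)
    calc X / K * Real.exp (-1) ≤ 1 * Real.exp (-1) := mul_le_mul_of_nonneg_right this (Real.exp_pos _).le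
      _ = Real.exp (-1) := one_mul _
  have hCle : ∀ {C : ℝ}, C ≤ Cm → C / K ≤ cK := fun h => div_le_div_of_nonneg_right h hKr.le
  have hC₂le : C₂ / K ≤ cK := hCle (by rw [hCm]; linarith)
  have hC₃le : C₃ / K ≤ cK := hCle (by rw [hCm]; linarith)
  have hC₄le : C₄ / K ≤ cK := hCle (by rw [hCm]; linarith)
  have hC₅le : C₅ / K ≤ cK := hCle (by rw [hCm]; linarith)
  -- the constant `c₀`
  set c₀ : ℝ := 2 ^ (d + 3) * Real.exp (19 / 8)
      * (Real.sqrt (Fintype.card ι) * C₁ + ((d : ℝ) + 1) * (D1 hprof + D2 hprof) / K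
          * ((Fintype.card ι : ℝ) * max (Real.sqrt (Fintype.card ι) * C₁) 2)) + 1 with hc₀
  have hc₀0 : 0 < c₀ := by positivity
  refine ⟨K, hK8, h8, c₀, hc₀0, fun creg β hcreg hβ => ?_⟩
  -- «for e sufficiently small»
  obtain ⟨e₁, he₁, h₁'⟩ := h₁ creg β hcreg hβ (2 * K) K hK1
  obtain ⟨e₂, he₂, h₂'⟩ := h₂ creg β hcreg hβ K hK2
  obtain ⟨e₃, he₃, h₃'⟩ := h₃ creg β hcreg hβ (2 * K) K hK2
  obtain ⟨e₄, he₄, h₄'⟩ := h₄ creg β hcreg hβ K hK2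
  obtain ⟨e₅, he₅, h₅'⟩ := cubeField_threshold d (c := 0) (aplus := aplus) hℓ₁ le_rfl ha hcreg hβ 1 K
  refine ⟨min (min (min e₁ e₂) (min e₃ e₄)) e₅, lt_min (lt_min (lt_min he₁ he₂) (lt_min he₃ he₄)) he₅, ?_⟩
  intro k hk hn a m2 ea1 ea2 em1 em2 Ωc hΩ Ac e he hle h17 μ x hxμ hxR P _ D hD f hfP V hV hfV i
  have hle₁ : e ≤ e₁ := hle.trans ((min_le_left _ _).trans ((min_le_left _ _).trans (min_le_left _ _)))
  have hle₂ : e ≤ e₂ := hle.trans ((min_le_left _ _).trans ((min_le_left _ _).trans (min_le_right _ _)))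
  have hle₃ : e ≤ e₃ := hle.trans ((min_le_left _ _).trans ((min_le_right _ _).trans (min_le_left _ _)))
  have hle₄ : e ≤ e₄ := hle.trans ((min_le_left _ _).trans ((min_le_right _ _).trans (min_le_right _ _)))
  have hle₅ : e ≤ e₅ := hle.trans (min_le_right _ _)
  have hn2 : 2 ≤ (ℓ + 1) ^ k := by
    calc 2 ≤ ℓ + 1 := by omega
      _ = (ℓ + 1) ^ 1 := (pow_one _).symm
      _ ≤ (ℓ + 1) ^ k := Nat.pow_le_pow_right (Nat.succ_pos ℓ) hk
  have hnK : 16 ≤ (ℓ + 1) ^ k * K := le_trans (by norm_num) (Nat.mul_le_mul hn2 hK8)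
  have hnK3 : 3 ≤ (ℓ + 1) ^ k * K := le_trans (by norm_num) hnK
  have ha' : 0 < a := lt_of_lt_of_le ha ea1
  have hL : (1 : ℝ) < (ℓ : ℝ) + 1 := by
    have : (1 : ℝ) ≤ ℓ := by exact_mod_cast hℓ
    linarith
  have hak : 0 < B1.aSeq a ((ℓ : ℝ) + 1) k := B1.aSeq_pos ha' hL hk
  obtain ⟨hak1, hak2⟩ := aSeq_window hℓ hk ha ea1 ea2
  have hvol : 0 ≤ (vol d ℓ k)⁻¹ ^ (2 : ℝ)⁻¹ := Real.rpow_nonneg (inv_nonneg.2 (vol_pos d ℓ k).le) _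
  -- the standard box data
  have hM1 : ∀ _i : Fin (d + 1), 1 ≤ 2 * K := fun _ => by omega
  have hMS : ∀ _i : Fin (d + 1), 2 * K ≤ 2 * K := fun _ => le_rfl
  have hKM : ∀ _i : Fin (d + 1), K ∣ 2 * K := fun _ => Dvd.intro_left 2 rfl
  have hj1 : ∀ _i : Fin (d + 1), (1 : ℤ) ≤ 1 := fun _ => le_rfl
  have hj2 : ∀ _i : Fin (d + 1), (K : ℤ) * (1 + 1) ≤ ((2 * K : ℕ) : ℤ) := fun _ => by push_cast; omega
  -- the main chain with the inputs discharged
  have main := thm110_deriv_region_of_inputs F (e / ((ℓ + 1) ^ k : ℕ)) hℓ hk hn Ωc hK8 hK4 hΩ ha' em1 Ac hC₁.le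
    hcK (n₀ := d + 1) (Nat.succ_pos d)
    -- Lemma 2.2 (2.17), sup member, at `Ã_j`
    (fun j hj Φ => (h₁' k hk hn hnK a m2 ea1 ea2 em1 em2 (fun _ => 2 * K) hM1 hMS (fun _ => 1) hj1 hj2
      (AcS ℓ k K Ac j) e he hle₁ (regular_AcS h17 hj) Φ).1)
    -- (2.20)
    (fun j hj Φ => (h₂' k hk hn hnK a m2 ea1 ea2 em1 em2 (AcS ℓ k K Ac j) e he hle₂ (regular_AcS h17 hj) Φ).trans
      (mul_le_mul_of_nonneg_right hC₂le (supN_nonneg Φ)))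
    -- the graded factor `‖·‖_{∞,p₁}` of (2.21)
    (fun j hj p hp Φ => by
      have hp' : 2 * ((d : ℝ) + 1) ≤ p := by push_cast at hp; linarith
      exact (h₄' k hk hn hnK a m2 ea1 ea2 em1 em2 (AcS ℓ k K Ac j) e he hle₄ (regular_AcS h17 hj) p hp' Φ).trans
        (mul_le_mul_of_nonneg_right hC₄le (lpW_nonneg d ℓ k p Φ)))
    -- (2.21)
    (fun j hj p q hp hpq hdiff Φ => by
      have hdiff' : p⁻¹ - q⁻¹ ≤ (2 * ((d : ℝ) + 1))⁻¹ := by push_cast at hdiff; exact hdiff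
      exact (h₃' k hk hn hnK a m2 ea1 ea2 em1 em2 (fun _ => 2 * K) hM1 hMS hKM (fun _ => 1) hj1 hj2
        (AcS ℓ k K Ac j) e he hle₃ (regular_AcS h17 hj) p q hp hpq hdiff' Φ).trans
        (mul_le_mul_of_nonneg_right hC₃le (lpW_nonneg d ℓ k p Φ)))
    -- Lemma 2.1's `‖·‖_{2,2}` at every cube, on the sub-region `Ω ∩ □̂_j`
    (fun j Φ => by
      obtain ⟨_, hsm, _⟩ := h₅' e he hle₅ _ hak1 hak2
      have hsmall : ℓ₁ ^ 2 * (((d : ℝ) + 1) * creg * e ^ β) ^ 2 * ((d : ℝ) + 1)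
          * (1 + B1.aSeq a ((ℓ : ℝ) + 1) k * ((d : ℝ) + 1)) ≤ min 2 (B1.aSeq a ((ℓ : ℝ) + 1) k) / 4 := by
        simpa only [Nat.cast_one, mul_one] using hsm
      have hL := eq221_l2_region_hZ F hℓ₁ hLip he hn hak em1 (subLabels Ωc K j) hcreg
        (fun y hy => h17 y (fineDom_mono hn (subLabels_subset Ωc K j) hy)) hsmall hnK3
        (isBlockUnion_subLabels Ωc hK1 hΩ j) j Φ
      have step : lpM 2 (kOpR F e hn (B1.aSeq a ((ℓ : ℝ) + 1) k) m2 (subLabels Ωc K j) Ac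
            (fun x => hZ ((ℓ + 1) ^ k) K j x.1)
          *ᵥ ((regionOp F e hn (B1.aSeq a ((ℓ : ℝ) + 1) k) m2 (subLabels Ωc K j) Ac)⁻¹
            *ᵥ (mulH (ι := ι) (fun x : ↥(fineDom ((ℓ + 1) ^ k) (subLabels Ωc K j)) => hZ ((ℓ + 1) ^ k) K j x.1)
              *ᵥ Φ))) ≤ cK * lpM 2 Φ := by
        refine hL.trans (mul_le_mul_of_nonneg_right ?_ (lpM_nonneg 2 Φ))
        refine le_trans ?_ hC₅le
        rw [hC₅]
        calc (2 * ((d : ℝ) + 1) * (Real.sqrt (min 2 (B1.aSeq a ((ℓ : ℝ) + 1) k) / 4 + m2))⁻¹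
              + (1 + B1.aSeq a ((ℓ : ℝ) + 1) k) * (min 2 (B1.aSeq a ((ℓ : ℝ) + 1) k) / 4 + m2)⁻¹)
              * (((d : ℝ) + 1) * (D1 hprof + D2 hprof)) / K
            = (2 * ((d : ℝ) + 1) * (Real.sqrt (min 2 (B1.aSeq a ((ℓ : ℝ) + 1) k) / 4 + m2))⁻¹
              + (1 + B1.aSeq a ((ℓ : ℝ) + 1) k) * (min 2 (B1.aSeq a ((ℓ : ℝ) + 1) k) / 4 + m2)⁻¹)
              * (((d : ℝ) + 1) * (D1 hprof + D2 hprof)) * (K : ℝ)⁻¹ := div_eq_mul_inv _ _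
          _ ≤ (2 * ((d : ℝ) + 1) * (Real.sqrt (min 2 (3 / 4 * amin) / 4))⁻¹
              + (1 + |aplus|) * (min 2 (3 / 4 * amin) / 4)⁻¹) * (((d : ℝ) + 1) * (D1 hprof + D2 hprof))
              * (K : ℝ)⁻¹ := mul_le_mul_of_nonneg_right (l2_const_le d ha hak1 hak2 em1 hs) (inv_nonneg.2 hKr.le)
          _ = _ := (div_eq_mul_inv _ _).symm
      show (vol d ℓ k)⁻¹ ^ (2 : ℝ)⁻¹ * lpM 2 _ ≤ cK * ((vol d ℓ k)⁻¹ ^ (2 : ℝ)⁻¹ * lpM 2 Φ)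
      calc (vol d ℓ k)⁻¹ ^ (2 : ℝ)⁻¹ * lpM 2 _ ≤ (vol d ℓ k)⁻¹ ^ (2 : ℝ)⁻¹ * (cK * lpM 2 Φ) :=
            mul_le_mul_of_nonneg_left step hvol
        _ = cK * ((vol d ℓ k)⁻¹ ^ (2 : ℝ)⁻¹ * lpM 2 Φ) := by ring)
    hC₁.le μ
    -- Lemma 2.2 (2.17), derivative sup member, at `Ã_j`
    (fun j hj Φ => ((h₁' k hk hn hnK a m2 ea1 ea2 em1 em2 (fun _ => 2 * K) hM1 hMS (fun _ => 1) hj1 hj2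
      (AcS ℓ k K Ac j) e he hle₁ (regular_AcS h17 hj) Φ).2 μ))
    h3 x hxμ
    (fun y hy => hxR y fun ν => by have h := hy ν; push_cast at h ⊢; linarith)
    P hD f hfP hV hfV i
  have hreg : regionOp F e hn (B1.aSeq a ((ℓ : ℝ) + 1) k) m2 Ωc Ac
      = covOp (regWt ((ℓ + 1) ^ k) (fineDom ((ℓ + 1) ^ k) Ωc)) m2
          (B1.aSeq a ((ℓ : ℝ) + 1) k * (((((ℓ + 1) ^ k : ℕ)) : ℝ) ^ (d + 1))⁻¹)
          (rBlkWt ((ℓ + 1) ^ k) Ωc (fineDom ((ℓ + 1) ^ k) Ωc)) (fieldLink F (e / ((ℓ + 1) ^ k : ℕ)) (acBond Ωc Ac))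
          (contourTrans (fieldLink F (e / ((ℓ + 1) ^ k : ℕ)) (acBond Ωc Ac)) (rbaseEmb hn Ωc)
            (rstairContour hn Ωc)) := rfl
  have hder : regionDeriv F e ((ℓ + 1) ^ k) Ωc Ac μ
      = covDeriv ((ℓ + 1) ^ k) (fineDom ((ℓ + 1) ^ k) Ωc) (fieldLink F (e / ((ℓ + 1) ^ k : ℕ)) (acBond Ωc Ac)) μ :=
    rfl
  rw [hreg, hder]
  have hV0 : 0 ≤ V := zero_le_one.trans hV
  refine main.trans ?_
  have hrest : 0 ≤ V * Real.exp (-(D / ((((ℓ + 1) ^ k : ℕ) : ℝ) * K))) * ‖f‖ := by positivity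
  have hle : 2 ^ (d + 3) * Real.exp (19 / 8)
      * (Real.sqrt (Fintype.card ι) * C₁ + ((d : ℝ) + 1) * (D1 hprof + D2 hprof) / K
          * ((Fintype.card ι : ℝ) * max (Real.sqrt (Fintype.card ι) * C₁) 2)) ≤ c₀ := by
    rw [hc₀]; linarith
  calc 2 ^ (d + 3) * Real.exp (19 / 8)
        * (Real.sqrt (Fintype.card ι) * C₁ + ((d : ℝ) + 1) * (D1 hprof + D2 hprof) / K
            * ((Fintype.card ι : ℝ) * max (Real.sqrt (Fintype.card ι) * C₁) 2))
        * V * Real.exp (-(D / ((((ℓ + 1) ^ k : ℕ) : ℝ) * K))) * ‖f‖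
      = (2 ^ (d + 3) * Real.exp (19 / 8)
        * (Real.sqrt (Fintype.card ι) * C₁ + ((d : ℝ) + 1) * (D1 hprof + D2 hprof) / K
            * ((Fintype.card ι : ℝ) * max (Real.sqrt (Fintype.card ι) * C₁) 2)))
        * (V * Real.exp (-(D / ((((ℓ + 1) ^ k : ℕ) : ℝ) * K))) * ‖f‖) := by ring
    _ ≤ c₀ * (V * Real.exp (-(D / ((((ℓ + 1) ^ k : ℕ) : ℝ) * K))) * ‖f‖) := mul_le_mul_of_nonneg_right hle hrest
    _ = c₀ * V * Real.exp (-(D / ((((ℓ + 1) ^ k : ℕ) : ℝ) * K))) * ‖f‖ := by ring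

/-- **THEOREM (1.10), derivative member, GENERAL `Ω` UNDER `R₀`, FOR `f` SUPPORTED IN ONE UNIT BLOCK** — the print's
reduction «it is sufficient to prove the Proposition for a function f with support in a unit cube» (pp. 574–575) applied to
`thm110_deriv_region` (`‖f‖_{2,η} ≤ √N‖f‖_∞`, `B4Thm110RegionLp.lpv_two_le_unitBlock`):
`|(D^η_{A,μ}G_k(Ω,A)f)(x)_i| ≤ c₀·exp(−D/(nK))·‖f‖_∞`. [cite: Balaban1983RegularityDecay, Theorem p.573 (1.10), §2 ¶1 p.575] -/
theorem thm110_deriv_region_unitBlock (F : OrthFlow ι) {ℓ₁ : ℝ} (hℓ₁ : 0 ≤ ℓ₁)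
    (hLip : ∀ t (v : ι → ℝ), ((F.U t - 1) *ᵥ v) ⬝ᵥ ((F.U t - 1) *ᵥ v) ≤ (ℓ₁ * t) ^ 2 * (v ⬝ᵥ v))
    (d ℓ : ℕ) (hℓ : 1 ≤ ℓ) (amin aplus m2plus : ℝ) (ha : 0 < amin) :
    ∃ K : ℕ, 8 ≤ K ∧ 8 ∣ K ∧ ∃ c₀ : ℝ, 0 < c₀ ∧ ∀ (creg β : ℝ), 0 ≤ creg → 0 < β →
      ∃ e₁ : ℝ, 0 < e₁ ∧ ∀ (k : ℕ), 1 ≤ k → ∀ (hn : 1 ≤ (ℓ + 1) ^ k) (a m2 : ℝ),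
      amin ≤ a → a ≤ aplus → 0 ≤ m2 → m2 ≤ m2plus →
      ∀ (Ωc : Finset (Fin (d + 1) → ℤ)), IsBlockUnion K Ωc →
      ∀ (Ac : (Fin (d + 1) → ℤ) → Fin (d + 1) → ℝ) (e : ℝ), 0 < e → e ≤ e₁ →
        (∀ x ∈ fineDom ((ℓ + 1) ^ k) Ωc, ∀ μ ν : Fin (d + 1),
          |Ac (x + e1 μ) ν - Ac x ν| ≤ creg * e ^ (β - 1) / ((ℓ + 1) ^ k : ℕ)) →
      ∀ (μ : Fin (d + 1)) (x : ↥(fineDom ((ℓ + 1) ^ k) Ωc)), x.1 + e1 μ ∈ fineDom ((ℓ + 1) ^ k) Ωc →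
        (∀ y : Fin (d + 1) → ℤ, (∀ ν, |y ν - blk ((ℓ + 1) ^ k) x.1 ν| ≤ (K : ℤ) * (d + 3) + 1) → y ∈ Ωc) →
      ∀ (y₀ : Fin (d + 1) → ℤ) (D : ℝ),
        (∀ x' : ↥(fineDom ((ℓ + 1) ^ k) Ωc), blk ((ℓ + 1) ^ k) x'.1 = y₀ →
          ∃ ν, D ≤ |rpos ((ℓ + 1) ^ k) Ωc x ν - rpos ((ℓ + 1) ^ k) Ωc x' ν|) →
      ∀ (f : ↥(fineDom ((ℓ + 1) ^ k) Ωc) × ι → ℝ), (∀ p, blk ((ℓ + 1) ^ k) p.1.1 ≠ y₀ → f p = 0) →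
      ∀ i : ι,
        |(regionDeriv F e ((ℓ + 1) ^ k) Ωc Ac μ
            *ᵥ ((regionOp F e hn (B1.aSeq a ((ℓ : ℝ) + 1) k) m2 Ωc Ac)⁻¹ *ᵥ f)) (x, i)|
          ≤ c₀ * Real.exp (-(D / ((((ℓ + 1) ^ k : ℕ) : ℝ) * K))) * ‖f‖ := by
  classical
  obtain ⟨K, hK8, h8, c₀, hc₀, H⟩ := thm110_deriv_region F hℓ₁ hLip d ℓ hℓ amin aplus m2plus ha
  refine ⟨K, hK8, h8, c₀ * max (Real.sqrt (Fintype.card ι)) 1, by positivity, fun creg β hcreg hβ => ?_⟩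
  obtain ⟨e₁, he₁, H'⟩ := H creg β hcreg hβ
  refine ⟨e₁, he₁, ?_⟩
  intro k hk hn a m2 ea1 ea2 em1 em2 Ωc hΩ Ac e he hle h17 μ x hxμ hxR y₀ D hD f hf i
  have hV : (1 : ℝ) ≤ max (Real.sqrt (Fintype.card ι)) 1 := le_max_right _ _
  have hfV : lpv (vol d ℓ k)⁻¹ 2 f ≤ max (Real.sqrt (Fintype.card ι)) 1 * ‖f‖ :=
    (lpv_two_le_unitBlock hn y₀ f hf).trans (mul_le_mul_of_nonneg_right (le_max_left _ _) (norm_nonneg f))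
  have h := H' k hk hn a m2 ea1 ea2 em1 em2 Ωc hΩ Ac e he hle h17 μ x hxμ hxR
    (fun x' => blk ((ℓ + 1) ^ k) x'.1 = y₀) D hD f (fun p hp => hf p hp) _ hV hfV i
  refine h.trans (le_of_eq ?_)
  ring

end Main

end

end Literature.MathematicalPhysics.QuantumFieldTheory.Balaban1983to89.B4Thm110RegionLpDeriv
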